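import Mathlib.LinearAlgebra.Eigenspace.Pi
import Literature.NumberTheory.EllipticCurves.NewformsOldNewGamma1Proofs
import Literature.NumberTheory.EllipticCurves.NewformsMainLemmaProofs
import Literature.NumberTheory.EllipticCurves.Gamma1FrickeFunctionalEquationProofs
import Literature.NumberTheory.EllipticCurves.NewformsHeckeStableProofs
import Literature.NumberTheory.EllipticCurves.HeckeOperatorsCommutativityProofs
import Literature.NumberTheory.EllipticCurves.CuspFormEpsConj
import HarnessLib

/-!
# Newforms span the new subspace of `S_k(Γ₁(N))` (Diamond–Shurman Thm. 5.8.2; the named fact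
# `span_newforms1` of `Newforms.lean`), from the Main Lemma on `Γ₁(N)` — with the Hecke and
# diamond stability of the old and new subspaces (Prop. 5.6.2) and `T_p^* = T_p ⟨p⟩⁻¹` (Thm. 5.5.3)

D-0014 keeps `Literature/` sorry-free by stating cited results as named facts `def X : Prop`.
`Newforms.lean` records **multiplicity one for `Γ₁(N)`** — Diamond–Shurman, *A first course in
modular forms*, Thm. 5.8.2 (PDF p. 218 of the held copy): "The set of newforms in the space
`S_k(Γ₁(N))^{new}` is an orthogonal basis of the space" (Li 1975, Thm. 3 and Cor. 3) — as the named
fact `span_newforms1 N k : Submodule.span ℂ (newforms1 N k) = newSubspace1 N k` (spanning part; for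
`N ≥ 1` and every weight `k ∈ ℤ`). This sibling file proves it **from exactly one named input, the
Main Lemma on `Γ₁(N)`** (Diamond–Shurman Thm. 5.7.1, the tree's unproved named fact
`atkinLehnerMainLemma1 N k` of `NewformsMainLemma`; its `Γ₀(N)` twin `atkinLehnerMainLemma0` is
proved in `NewformsMainLemmaTraceProofs`):

* `span_newforms1_of_mainLemma1 : atkinLehnerMainLemma1 N k → span_newforms1 N k`,

so that the discharge `span_newforms1_holds` is the one-liner
`span_newforms1_of_mainLemma1 N k (atkinLehnerMainLemma1_holds N k)` once Thm. 5.7.1 lands. No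
definition and no new named fact is introduced; everything else the printed proof uses is proved
here or already in the tree. This is the `Γ₁(N)` twin of the tree's `Γ₀(N)` files
`NewformsOldHeckeStableProofs`, `NewformsHeckeStableProofs`, `NewformsSpanProofs`
(`span_newforms0_holds`), with the two differences of the `Γ₁(N)` theory handled explicitly: the
diamond operators `⟨d⟩` enter the commuting family, and `T_p` (`p ∤ N`) is only *normal*,
`T_p^* = ⟨p⟩⁻¹ T_p` (Thm. 5.5.3), not self-adjoint.

Throughout, `[α_d]_k = degeneracyMap1 M N d k = [Γ₁(M) diag(d,1) Γ₁(N)]` (`= g ↦ g ∣[k] diag(d,1)`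
for `M d ∣ N`, `coe_degeneracyMap1_eq_slash`; Diamond–Shurman's `ι_d = d^{1-k} [α_d]_k`),
`old = oldSubspace1 N k = Σ range [α_d]_k`, `new = newSubspace1 N k = ⋂ ker [Γ₁(N) diag(1,d) Γ₁(M)]`
(the algebraic new subspace; `= old^⊥` by `newSubspace1_eq_orthogonal_holds`), `T_p = heckeT`,
`⟨d⟩ = diamondOp`, `w_N = frickeInvolution1` (`Gamma1FrickeFunctionalEquationProofs`).

## Contents (all proved)

1. `cuspCoeff_degeneracyMap1` — `a_n([α_d] g) = d^{k-1} 𝟙_{d∣n} a_{n/d}(g)` (§5.7, p. 211: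
   `ι_d : ∑ a_n qⁿ ↦ ∑ a_n q^{dn}`); `heckeT_degeneracyMap1_of_not_dvd`, `heckeT_degeneracyMap1_mul`,
   `heckeT_degeneracyMap1_of_dvd_of_not_dvd` — the commutation rules of `T_p`/`U_p` with the
   degeneracy maps (Prop. 5.6.2, first and second diagrams: `T_p [α_d] = [α_d] T_p` for `p ∤ d`,
   `U_p [α_{pe}] = p^{k-1} [α_e]`, `U_p [α_d] = [α_d] T_p - [α_{dp}] ⟨p⟩`), on `q`-expansions
   (Prop. 5.2.2(a), `qExpansion_coeff_heckeT_gamma1_holds`) with `⟨p⟩_N [α_d] = [α_d] ⟨p⟩_M`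
   (`diamondOp_degeneracyMap1`); `heckeT_mem_oldSubspace1`, `diamondOp_mem_oldSubspace1` —
   **`old` is stable under every `T_p` (`U_p` for `p ∣ N`) and every `⟨d⟩`** (Prop. 5.6.2, old half).
2. `coe_cuspHeckeOperator_mul_of_normaliser` — `[Γ (g e) Γ] f = ([Γ g Γ] f) ∣[k] e` for `e`
   normalising `Γ`; `exists_heckeTAdjoint_eq_heckeT_mul_diamondOp` — **Thm. 5.5.3 on `Γ₁(N)`**: for
   `p ∤ N`, `[Γ₁(N) diag(p,1) Γ₁(N)] = T_p ⟨u⟩` with `u p ≡ 1 (mod N)`, by the printed factorisation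
   `diag(p,1) = (up, v; -N, 1) diag(1,p) (p, -v; N, u)` (pp. 207–208), while
   `[Γ₁(N) diag(p,1) Γ₁(N)]` is the Petersson adjoint of `T_p` (Prop. 5.5.2(b), the tree's
   `cuspHeckeOperator_adjoint`; `peterssonProduct_heckeT_left_gamma1`);
   `peterssonProduct_diamondOp_left` — **`⟨d⟩^* = ⟨d⁻¹⟩`**.
3. `frickeInvolution1_heckeT_frickeInvolution1` — `w_N T_p w_N = (-1)^k [Γ₁(N) diag(p,1) Γ₁(N)]`
   (Ex. 5.5.1: `T^* = w_N T w_N⁻¹`); `frickeInvolution1_mem_oldSubspace1` — `w_N` preserves `old`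
   (Prop. 5.6.2, third diagram: `diag(d,1) w_N = (d·1) w_M diag(d',1)`); `heckeT_mem_newSubspace1`,
   `heckeTAdjoint_mem_newSubspace1`, `diamondOp_mem_newSubspace1` — **`new` is stable under every
   `T_p`, under the adjoints, and under every `⟨d⟩`** (Prop. 5.6.2, new half, as printed, p. 210:
   "it is enough to show that `S_k(Γ₁(N))^{old}` is stable under the adjoints"), using `new ⊥ old`
   and "the right orthogonal of `old` is `new`" (`NewformsOldNewGamma1Proofs`).
4. `maxGenEigenspace_eq_eigenspace_of_normal` — a normal operator for a definite Hermitian form has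
   no Jordan blocks (the linear algebra of Thm. 5.5.4 / Cor. 5.6.3);
   `cuspCoeff_eq_zero_of_coprime_gamma1` — an eigenform away from `N` with `a₁ = 0` has `a_n = 0`
   for `(n, N) = 1` ((5.21), by induction on `n` through Prop. 5.2.2(a) instead of the `T_n`).
5. Given the Main Lemma: `mem_oldSubspace1_of_coeff_eq_zero` (such a form is old, Thm. 5.7.1 with
   Def. 5.6.1), `eq_zero_of_mem_newSubspace1_of_coeff_one_eq_zero`,
   `exists_isNewform1_of_mem_newSubspace1` (**Thm. 5.8.2(a)**: a nonzero new eigenform away from `N`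
   has `a₁ ≠ 0` and is `a₁` times a newform — for `p ∣ N` via `g = U_p f - a₁(U_p f) f ∈ new ∩ old`),
   and the assembly `span_newforms1_of_mainLemma1` (finite-dimensionality
   `finiteDimensional_cuspForm_gamma1`; joint generalised eigenspaces of the commuting family
   `{T_p|_new : p ∤ N} ∪ {⟨d⟩|_new}`, Mathlib
   `Module.End.iSup_iInf_maxGenEigenspace_eq_top_of_iSup_maxGenEigenspace_eq_top_of_commute`,
   `heckeT_comm_of_prime`, `heckeT_diamondOp_comm_holds`; normality from items 2–3).

## References

* F. Diamond, J. Shurman, *A first course in modular forms*, GTM 228, Springer 2005 (lit store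
  `book:diamond2005-first-course-modular-forms`), Prop. 5.2.2 (PDF p. 171), Prop. 5.5.2,
  Thm. 5.5.3 with its proof and Thm. 5.5.4 (PDF pp. 206–208), Ex. 5.5.1, Def. 5.6.1, Prop. 5.6.2,
  Cor. 5.6.3 and Ex. 5.6.3 (PDF pp. 209–210), Thm. 5.7.1 (PDF p. 211), Def. 5.8.1 and Thm. 5.8.2
  with its proof (PDF pp. 216–218). doi:10.1007/978-0-387-27226-9
* W.-C. W. Li, *Newforms and functional equations*, Math. Ann. 212 (1975), 285–315, §2 Lemma 5,
  Thm. 3 and Cor. 3 (doi:10.1007/BF01344466; not held — paywalled, WANTED filed 2026-08-15; the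
  statement is used as vendored in `Newforms.lean` and as printed by Diamond–Shurman).
* A. O. L. Atkin, J. Lehner, *Hecke operators on `Γ₀(m)`*, Math. Ann. 185 (1970), 134–160, Thm. 5,
  Lemma 26 (the `Γ₀(N)` case).
-/

noncomputable section

open scoped MatrixGroups ModularForm ComplexConjugate

open CongruenceSubgroup UpperHalfPlane Matrix.SpecialLinearGroup ConjAct Pointwise

namespace Literature.NumberTheory.EllipticCurves.ModularForms

/-! ### `q`-expansions on `Γ₁(N)`: linearity and the degeneracy maps -/

section QExp

variable {N : ℕ} {k : ℤ}

/-- `a_n(c • f) = c a_n(f)` on `S_k(Γ₁(N))`. [folklore] -/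
theorem cuspCoeff_smul_gamma1 (c : ℂ) (f : CuspForm (Gamma1 N) k) (n : ℕ) :
    cuspCoeff (c • f) n = c * cuspCoeff f n := by
  simp only [cuspCoeff]
  rw [CuspForm.IsGLPos.coe_smul,
    ModularForm.qExpansion_smul one_pos (HeckeTGamma1.one_mem_strictPeriods_Gamma1 N) _ f,
    map_smul, smul_eq_mul]

/-- `a_n(f - g) = a_n(f) - a_n(g)` on `S_k(Γ₁(N))`. [folklore] -/
theorem cuspCoeff_sub_gamma1 (f g : CuspForm (Gamma1 N) k) (n : ℕ) :
    cuspCoeff (f - g) n = cuspCoeff f n - cuspCoeff g n := by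
  simp only [cuspCoeff]
  rw [CuspForm.coe_sub,
    ModularForm.qExpansion_sub one_pos (HeckeTGamma1.one_mem_strictPeriods_Gamma1 N) f g, map_sub]

/-- `a_n(f + g) = a_n(f) + a_n(g)` on `S_k(Γ₁(N))`. [folklore] -/
theorem cuspCoeff_add_gamma1 (f g : CuspForm (Gamma1 N) k) (n : ℕ) :
    cuspCoeff (f + g) n = cuspCoeff f n + cuspCoeff g n := by
  simp only [cuspCoeff]
  rw [CuspForm.coe_add,
    ModularForm.qExpansion_add one_pos (HeckeTGamma1.one_mem_strictPeriods_Gamma1 N) f g, map_add]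

variable [NeZero N]

/-- `a_n(T_p f)` on `S_k(Γ₁(N))` (Diamond–Shurman Prop. 5.2.2(a), (5.3)), restated for
`cuspCoeff` from `qExpansion_coeff_heckeT_gamma1_holds`. [cite: DiamondShurman2005, Prop. 5.2.2(a)] -/
theorem cuspCoeff_heckeT_gamma1 (f : CuspForm (Gamma1 N) k) (p : ℕ) [NeZero p] (hp : p.Prime)
    (n : ℕ) :
    cuspCoeff (heckeT (Gamma1 N) k p f) n =
      cuspCoeff f (p * n) +
        (if p ∣ N then 0
         else (p : ℂ) ^ (k - 1) * (if p ∣ n then cuspCoeff (diamondOp N k p f) (n / p) else 0)) :=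
  qExpansion_coeff_heckeT_gamma1_holds N k f p hp n

/-- **`q`-expansion of the degeneracy map on `Γ₁`**: for `M d ∣ N` and `g ∈ S_k(Γ₁(M))`,
`a_n([α_d]_k g) = d^{k-1} a_{n/d}(g)` if `d ∣ n` and `0` otherwise — Diamond–Shurman §5.7, p. 211:
`ι_d = d^{1-k}[α_d]_k` acts on Fourier expansions by `∑ a_n qⁿ ↦ ∑ a_n q^{dn}`; here for the
un-normalised `degeneracyMap1 M N d k = [α_d]_k` (`coe_degeneracyMap1_eq_slash`), whence the factor
`d^{k-1}` of Mathlib's slash action. [cite: DiamondShurman2005, §5.7 p. 211] -/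
theorem cuspCoeff_degeneracyMap1 {M d : ℕ} [NeZero M] [NeZero d] (hMd : M * d ∣ N)
    (g : CuspForm (Gamma1 M) k) (n : ℕ) :
    cuspCoeff (degeneracyMap1 M N d k g) n =
      (d : ℂ) ^ (k - 1) * (if d ∣ n then cuspCoeff g (n / d) else 0) := by
  have hd : 0 < d := NeZero.pos d
  have hd0 : (d : ℂ) ≠ 0 := Nat.cast_ne_zero.mpr hd.ne'
  set F := degeneracyMap1 M N d k g with hF_def
  -- `F τ = d^{k-1} g(dτ)`
  have hFτ : ∀ τ : ℍ, F τ = (d : ℂ) ^ (k - 1) *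
      g ⟨(d : ℂ) * τ, by simpa using mul_pos (Nat.cast_pos.mpr hd) τ.2⟩ := fun τ ↦ by
    have h1 := smul_slash_diagGL_apply k d hd ⇑g τ
    rw [← coe_degeneracyMap1_eq_slash M N d k hMd g, Pi.smul_apply, smul_eq_mul] at h1
    have h2 : ((⟨(d : ℝ), Nat.cast_pos.mpr hd⟩ : {x : ℝ // 0 < x}) • τ : ℍ) =
        ⟨(d : ℂ) * τ, by simpa using mul_pos (Nat.cast_pos.mpr hd) τ.2⟩ := by
      apply UpperHalfPlane.ext
      simp [UpperHalfPlane.coe_pos_real_smul]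
    rw [h2] at h1
    rw [← h1, ← mul_assoc, ← zpow_add₀ hd0, show k - 1 + (1 - k) = 0 by ring, zpow_zero, one_mul]
  symm
  refine ModularFormClass.qExpansion_coeff_unique one_pos (HeckeTGamma1.one_mem_strictPeriods_Gamma1 N)
    (f := F) (c := fun m ↦ (d : ℂ) ^ (k - 1) * (if d ∣ m then cuspCoeff g (m / d) else 0))
    (fun τ ↦ ?_) n
  set τ' : ℍ := ⟨(d : ℂ) * τ, by simpa using mul_pos (Nat.cast_pos.mpr hd) τ.2⟩ with hτ'
  have hg := hasSum_qExpansion_of_mem_strictPeriods one_pos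
    (HeckeTGamma1.one_mem_strictPeriods_Gamma1 M) g τ'
  have hq : Function.Periodic.qParam 1 (τ' : ℂ) = Function.Periodic.qParam 1 τ ^ d :=
    qParam_one_natMul d τ
  rw [hq] at hg
  rw [hFτ τ]
  have hg' := hg.mul_left ((d : ℂ) ^ (k - 1))
  refine ((mul_right_injective₀ hd.ne').hasSum_iff ?_).mp ?_
  · intro m hm
    have : ¬ d ∣ m := by
      rintro ⟨j, rfl⟩
      exact hm ⟨j, rfl⟩
    simp [this]
  · have hfun : ((fun m ↦ ((d : ℂ) ^ (k - 1) * (if d ∣ m then cuspCoeff g (m / d) else 0)) •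
        Function.Periodic.qParam 1 τ ^ m) ∘ fun x ↦ d * x) =
        fun i ↦ (d : ℂ) ^ (k - 1) *
          ((qExpansion 1 ⇑g).coeff i • (Function.Periodic.qParam 1 τ ^ d) ^ i) := by
      funext m
      simp only [Function.comp_apply, smul_eq_mul, cuspCoeff]
      rw [if_pos (dvd_mul_right d m), Nat.mul_div_cancel_left m hd, pow_mul, mul_assoc]
    rw [hfun]
    exact hg'

end QExp

/-! ### Hecke and diamond operators versus the degeneracy maps (Diamond–Shurman Prop. 5.6.2, old half) -/

section Commutation

/-- Two forms on `Γ₁(N)` agree iff their Fourier coefficients do (`q`-expansion principle,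
`eq_of_forall_cuspCoeff_eq` with `T ∈ Γ₁(N)`). [folklore] -/
theorem eq_of_forall_cuspCoeff_eq_gamma1 {N : ℕ} {k : ℤ} {f g : CuspForm (Gamma1 N) k}
    (h : ∀ n, cuspCoeff f n = cuspCoeff g n) : f = g :=
  eq_of_forall_cuspCoeff_eq (HeckeTGamma1.one_mem_strictPeriods_Gamma1 N) h

variable {M N d : ℕ} [NeZero M] [NeZero N] [NeZero d] (k : ℤ) {p : ℕ} [NeZero p]

omit [NeZero p] in
/-- `⟨p⟩_N ∘ [α_d]_k = [α_d]_k ∘ ⟨p⟩_M` for a prime `p ∤ N` and `M d ∣ N` (Diamond–Shurman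
Prop. 5.6.2, first diagram with `T = ⟨p⟩`; `diamondOp_degeneracyMap1` with the unit `p` of
`ℤ/Nℤ`). [cite: DiamondShurman2005, Prop. 5.6.2] -/
theorem diamondOp_natCast_degeneracyMap1 (hMd : M * d ∣ N) (hp : p.Prime) (hpN : ¬ p ∣ N)
    (g : CuspForm (Gamma1 M) k) :
    diamondOp N k (p : ZMod N) (degeneracyMap1 M N d k g) =
      degeneracyMap1 M N d k (diamondOp M k (p : ZMod M) g) := by
  rw [diamondOp_degeneracyMap1 N k hMd (ZMod.isUnit_prime_of_not_dvd hp hpN) g, map_natCast]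

/-- **`T_p [α_d]_k = [α_d]_k T_p` when `p ∤ d` and `p` divides `M` iff it divides `N`**
(`M d ∣ N`, `g ∈ S_k(Γ₁(M))`): for `p ∤ N` these are the genuine `T_p` at levels `N` and `M`
(Diamond–Shurman Prop. 5.6.2, first diagram, and Ex. 5.8.6(a): "`T_p(f(nτ)) = (T_p f)(nτ)`"),
for `p ∣ M` the operators `U_p`. Proof on `q`-expansions (Prop. 5.2.2(a)): both sides have
`a_n = d^{k-1} 𝟙_{d∣n} (a_{pn/d}(g) + 𝟙_{p∤N} p^{k-1} 𝟙_{p∣n/d} a_{n/(dp)}(⟨p⟩ g))`, using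
`⟨p⟩_N [α_d]_k = [α_d]_k ⟨p⟩_M`. [cite: DiamondShurman2005, Prop. 5.6.2 (proof, first diagram)] -/
theorem heckeT_degeneracyMap1_of_not_dvd (hMd : M * d ∣ N) (hp : p.Prime) (hpd : ¬ p ∣ d)
    (hMN : p ∣ M ↔ p ∣ N) (g : CuspForm (Gamma1 M) k) :
    heckeT (Gamma1 N) k p (degeneracyMap1 M N d k g) =
      degeneracyMap1 M N d k (heckeT (Gamma1 M) k p g) := by
  have hcop : Nat.Coprime d p := Nat.coprime_comm.mp ((Nat.Prime.coprime_iff_not_dvd hp).mpr hpd)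
  refine eq_of_forall_cuspCoeff_eq_gamma1 fun n ↦ ?_
  rw [cuspCoeff_heckeT_gamma1 _ p hp, cuspCoeff_degeneracyMap1 hMd, cuspCoeff_degeneracyMap1 hMd,
    cuspCoeff_heckeT_gamma1 _ p hp]
  by_cases hpN : p ∣ N
  · rw [if_pos hpN, if_pos (hMN.mpr hpN), add_zero, add_zero]
    by_cases hdn : d ∣ n
    · rw [if_pos (dvd_mul_of_dvd_right hdn p), if_pos hdn, Nat.mul_div_assoc p hdn]
    · have hdpn : ¬ d ∣ p * n := fun h' ↦ hdn ((hcop.dvd_mul_left).mp h')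
      rw [if_neg hdpn, if_neg hdn]
  · have hpM : ¬ p ∣ M := fun h ↦ hpN (hMN.mp h)
    rw [if_neg hpN, if_neg hpM, diamondOp_natCast_degeneracyMap1 k hMd hp hpN,
      cuspCoeff_degeneracyMap1 hMd]
    by_cases hdn : d ∣ n
    · rw [if_pos (dvd_mul_of_dvd_right hdn p), if_pos hdn, Nat.mul_div_assoc p hdn]
      by_cases hpn : p ∣ n
      · have hdp : d * p ∣ n := Nat.Coprime.mul_dvd_of_dvd_of_dvd hcop hdn hpn
        have h1 : d ∣ n / p := (Nat.dvd_div_iff_mul_dvd hpn).mpr (by rwa [mul_comm] at hdp)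
        have h2 : p ∣ n / d := (Nat.dvd_div_iff_mul_dvd hdn).mpr hdp
        rw [if_pos hpn, if_pos h1, if_pos h2, Nat.div_div_eq_div_mul, Nat.div_div_eq_div_mul,
          mul_comm p d]
        ring
      · have h2 : ¬ p ∣ n / d := fun h2 ↦ hpn (h2.trans (Nat.div_dvd_of_dvd hdn))
        rw [if_neg hpn, if_neg h2]
        ring
    · have hdpn : ¬ d ∣ p * n := fun h' ↦ hdn ((hcop.dvd_mul_left).mp h')
      rw [if_neg hdpn, if_neg hdn]
      split_ifs with hpn hdnp
      · exact absurd (hdnp.trans (Nat.div_dvd_of_dvd hpn)) hdn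
      · ring
      · ring

omit [NeZero d] in
/-- **`U_p [α_{pe}]_k = p^{k-1} [α_e]_k`** for `p ∣ N` (`M p e ∣ N`, `g ∈ S_k(Γ₁(M))`): on
`q`-expansions `a_n(U_p [α_{pe}] g) = a_{pn}([α_{pe}] g) = (pe)^{k-1} 𝟙_{e∣n} a_{n/e}(g)`
(Diamond–Shurman Prop. 5.6.2, second diagram: the entry `U_p ∘ [α_p]_k = p^{k-1}`).
[cite: DiamondShurman2005, Prop. 5.6.2 (proof, second diagram)] -/
theorem heckeT_degeneracyMap1_mul {e : ℕ} [NeZero e] [NeZero (p * e)] (h : M * (p * e) ∣ N)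
    (h' : M * e ∣ N) (hp : p.Prime) (hpN : p ∣ N) (g : CuspForm (Gamma1 M) k) :
    heckeT (Gamma1 N) k p (degeneracyMap1 M N (p * e) k g) =
      (p : ℂ) ^ (k - 1) • degeneracyMap1 M N e k g := by
  refine eq_of_forall_cuspCoeff_eq_gamma1 fun n ↦ ?_
  rw [cuspCoeff_heckeT_gamma1 _ p hp, if_pos hpN, add_zero, cuspCoeff_degeneracyMap1 h,
    cuspCoeff_smul_gamma1, cuspCoeff_degeneracyMap1 h', Nat.mul_div_mul_left n e hp.pos,
    Nat.cast_mul, mul_zpow, mul_assoc]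
  by_cases hen : e ∣ n
  · rw [if_pos hen, if_pos (mul_dvd_mul_left p hen)]
  · rw [if_neg hen, if_neg (fun h'' ↦ hen ((Nat.mul_dvd_mul_iff_left hp.pos).mp h''))]

/-- **`U_p [α_d]_k = [α_d]_k T_p - [α_{dp}]_k ⟨p⟩`** for `p ∣ N`, `p ∤ M`, `p ∤ d` (`M d p ∣ N`,
`g ∈ S_k(Γ₁(M))`; `T_p` the genuine Hecke operator at level `M`): on `q`-expansions
`a_n(U_p [α_d] g) = d^{k-1} 𝟙_{d∣n} a_{pn/d}(g)`, while
`a_n([α_d] T_p g) = d^{k-1} 𝟙_{d∣n} (a_{pn/d}(g) + p^{k-1} 𝟙_{p∣n/d} a_{n/(dp)}(⟨p⟩ g))` and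
`a_n([α_{dp}] ⟨p⟩ g) = (dp)^{k-1} 𝟙_{dp∣n} a_{n/(dp)}(⟨p⟩ g)` (Diamond–Shurman Prop. 5.6.2, second
diagram: the column `(T_p, -⟨p⟩)` of the matrix). [cite: DiamondShurman2005, Prop. 5.6.2 (proof, second diagram)] -/
theorem heckeT_degeneracyMap1_of_dvd_of_not_dvd [NeZero (d * p)] (hMd : M * d ∣ N)
    (h2 : M * (d * p) ∣ N) (hp : p.Prime) (hpN : p ∣ N) (hpM : ¬ p ∣ M) (hpd : ¬ p ∣ d)
    (g : CuspForm (Gamma1 M) k) :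
    heckeT (Gamma1 N) k p (degeneracyMap1 M N d k g) =
      degeneracyMap1 M N d k (heckeT (Gamma1 M) k p g) -
        degeneracyMap1 M N (d * p) k (diamondOp M k (p : ZMod M) g) := by
  have hcop : Nat.Coprime d p := Nat.coprime_comm.mp ((Nat.Prime.coprime_iff_not_dvd hp).mpr hpd)
  refine eq_of_forall_cuspCoeff_eq_gamma1 fun n ↦ ?_
  rw [cuspCoeff_heckeT_gamma1 _ p hp, if_pos hpN, add_zero, cuspCoeff_degeneracyMap1 hMd,
    cuspCoeff_sub_gamma1, cuspCoeff_degeneracyMap1 hMd, cuspCoeff_degeneracyMap1 h2,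
    cuspCoeff_heckeT_gamma1 _ p hp, if_neg hpM, Nat.cast_mul, mul_zpow]
  by_cases hdn : d ∣ n
  · rw [if_pos (dvd_mul_of_dvd_right hdn p), if_pos hdn, Nat.mul_div_assoc p hdn]
    by_cases hpn : p ∣ n / d
    · have hdp : d * p ∣ n := (Nat.dvd_div_iff_mul_dvd hdn).mp hpn
      rw [if_pos hpn, if_pos hdp, Nat.div_div_eq_div_mul]
      ring
    · have hdp : ¬ d * p ∣ n := fun hdp ↦ hpn ((Nat.dvd_div_iff_mul_dvd hdn).mpr hdp)
      rw [if_neg hpn, if_neg hdp]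
      ring
  · have hdpn : ¬ d ∣ p * n := fun h' ↦ hdn ((hcop.dvd_mul_left).mp h')
    have hdp : ¬ d * p ∣ n := fun hdp ↦ hdn ((dvd_mul_right d p).trans hdp)
    rw [if_neg hdpn, if_neg hdn, if_neg hdp]
    ring

end Commutation

/-! ### The old subspace of `S_k(Γ₁(N))` is stable under the `T_p` and the `⟨d⟩` -/

section OldStable

variable (N : ℕ) [NeZero N] (k : ℤ)

/-- For `M` a proper divisor of `N` and `M d ∣ N`, `[α_d]_k (S_k(Γ₁(M))) ⊆ S_k(Γ₁(N))^{old}`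
(`oldSubspace1` of `Newforms.lean`; Diamond–Shurman Def. 5.6.1). [folklore] -/
theorem range_degeneracyMap1_le_oldSubspace1 {M d : ℕ} [NeZero M] [NeZero d]
    (hM : M ∈ N.properDivisors) (hMd : M * d ∣ N) :
    LinearMap.range (degeneracyMap1 M N d k) ≤ oldSubspace1 N k :=
  le_iSup (fun Md : DegeneracyIndex N ↦ LinearMap.range (degeneracyMap1 Md.1.1 N Md.1.2 k))
    ⟨(M, d), hM, hMd⟩

/-- **The old subspace `S_k(Γ₁(N))^{old}` is stable under `T_p` for every prime `p`**
(Diamond–Shurman Prop. 5.6.2, old half: "The two diagrams combine to show that `S_k(Γ₁(N))^{old}`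
is stable under all `T_n` and `⟨n⟩`"; for `p ∣ N` the operator is `U_p`). On a generator
`[α_d]_k g`, `g ∈ S_k(Γ₁(M))`, `M d ∣ N`: `T_p [α_d] g` is `p^{k-1} [α_{d/p}] g` if `p ∣ d`
(`heckeT_degeneracyMap1_mul`), `[α_d] T_p g` if `p ∤ d` and `p ∣ M ↔ p ∣ N`
(`heckeT_degeneracyMap1_of_not_dvd`), and `[α_d] T_p g - [α_{dp}] ⟨p⟩ g` if `p ∣ N`, `p ∤ M d`
(`heckeT_degeneracyMap1_of_dvd_of_not_dvd`; then `M d p ∣ N`). [cite: DiamondShurman2005, Prop. 5.6.2] -/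
theorem heckeT_mem_oldSubspace1 {p : ℕ} [NeZero p] (hp : p.Prime) {f : CuspForm (Gamma1 N) k}
    (hf : f ∈ oldSubspace1 N k) : heckeT (Gamma1 N) k p f ∈ oldSubspace1 N k := by
  have hf' : f ∈ ⨆ Md : DegeneracyIndex N, LinearMap.range (degeneracyMap1 Md.1.1 N Md.1.2 k) := hf
  refine Submodule.iSup_induction _
    (motive := fun f ↦ heckeT (Gamma1 N) k p f ∈ oldSubspace1 N k) hf' ?_ ?_ ?_
  · rintro ⟨⟨M, d⟩, hM, hMd⟩ f hf''
    obtain ⟨g, rfl⟩ := LinearMap.mem_range.mp hf''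
    dsimp only at g hMd ⊢
    haveI hM0 : NeZero M := ⟨(Nat.pos_of_mem_properDivisors hM).ne'⟩
    haveI hd0 : NeZero d := ⟨fun hd ↦ NeZero.ne N (Nat.eq_zero_of_zero_dvd (by simpa [hd] using hMd))⟩
    have hMN : M ∣ N := (dvd_mul_right M d).trans hMd
    by_cases hpd : p ∣ d
    · -- `p ∣ d`: `U_p [α_{pe}] g = p^{k-1} [α_e] g`
      obtain ⟨e, rfl⟩ := hpd
      haveI he0 : NeZero e := ⟨fun he ↦ NeZero.ne (p * e) (by rw [he, mul_zero])⟩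
      have h' : M * e ∣ N := (mul_dvd_mul_left M (dvd_mul_left e p)).trans hMd
      have hpN : p ∣ N := ((dvd_mul_right p e).trans (dvd_mul_left (p * e) M)).trans hMd
      rw [heckeT_degeneracyMap1_mul k hMd h' hp hpN]
      exact Submodule.smul_mem _ _
        (range_degeneracyMap1_le_oldSubspace1 N k hM h' (LinearMap.mem_range_self _ _))
    · by_cases hpN : p ∣ N
      · by_cases hpM : p ∣ M
        · rw [heckeT_degeneracyMap1_of_not_dvd k hMd hp hpd ⟨fun _ ↦ hpN, fun _ ↦ hpM⟩]
          exact range_degeneracyMap1_le_oldSubspace1 N k hM hMd (LinearMap.mem_range_self _ _)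
        · -- `p ∣ N`, `p ∤ M d`
          have hcop : Nat.Coprime p (M * d) :=
            Nat.Coprime.mul_right ((Nat.Prime.coprime_iff_not_dvd hp).mpr hpM)
              ((Nat.Prime.coprime_iff_not_dvd hp).mpr hpd)
          have h2 : M * (d * p) ∣ N := by
            rw [← mul_assoc]
            exact Nat.Coprime.mul_dvd_of_dvd_of_dvd hcop.symm hMd hpN
          haveI : NeZero (d * p) := ⟨mul_ne_zero (NeZero.ne d) (NeZero.ne p)⟩
          rw [heckeT_degeneracyMap1_of_dvd_of_not_dvd k hMd h2 hp hpN hpM hpd]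
          refine Submodule.sub_mem _ ?_ ?_
          · exact range_degeneracyMap1_le_oldSubspace1 N k hM hMd (LinearMap.mem_range_self _ _)
          · exact range_degeneracyMap1_le_oldSubspace1 N k hM h2 (LinearMap.mem_range_self _ _)
      · have hpM : ¬ p ∣ M := fun hpM ↦ hpN (hpM.trans hMN)
        rw [heckeT_degeneracyMap1_of_not_dvd k hMd hp hpd ⟨fun h ↦ absurd h hpM, fun h ↦ absurd h hpN⟩]
        exact range_degeneracyMap1_le_oldSubspace1 N k hM hMd (LinearMap.mem_range_self _ _)
  · rw [map_zero]
    exact Submodule.zero_mem _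
  · intro f g hf hg
    rw [map_add]
    exact Submodule.add_mem _ hf hg

/-- **The old subspace `S_k(Γ₁(N))^{old}` is stable under the diamond operators** (Diamond–Shurman
Prop. 5.6.2, old half, `T = ⟨d⟩`): `⟨d⟩_N [α_e]_k g = [α_e]_k ⟨d mod M⟩_M g`
(`diamondOp_degeneracyMap1`). [cite: DiamondShurman2005, Prop. 5.6.2] -/
theorem diamondOp_mem_oldSubspace1 (d : ZMod N) {f : CuspForm (Gamma1 N) k}
    (hf : f ∈ oldSubspace1 N k) : diamondOp N k d f ∈ oldSubspace1 N k := by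
  by_cases hd : IsUnit d
  swap
  · rwa [diamondOp_of_not_isUnit hd, LinearMap.id_apply]
  have hf' : f ∈ ⨆ Md : DegeneracyIndex N, LinearMap.range (degeneracyMap1 Md.1.1 N Md.1.2 k) := hf
  refine Submodule.iSup_induction _
    (motive := fun f ↦ diamondOp N k d f ∈ oldSubspace1 N k) hf' ?_ ?_ ?_
  · rintro ⟨⟨M, e⟩, hM, hMe⟩ f hf''
    obtain ⟨g, rfl⟩ := LinearMap.mem_range.mp hf''
    dsimp only at g hMe ⊢
    haveI hM0 : NeZero M := ⟨(Nat.pos_of_mem_properDivisors hM).ne'⟩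
    haveI he0 : NeZero e := ⟨fun he ↦ NeZero.ne N (Nat.eq_zero_of_zero_dvd (by simpa [he] using hMe))⟩
    rw [diamondOp_degeneracyMap1 N k hMe hd g]
    exact range_degeneracyMap1_le_oldSubspace1 N k hM hMe (LinearMap.mem_range_self _ _)
  · rw [map_zero]
    exact Submodule.zero_mem _
  · intro f g hf hg
    rw [map_add]
    exact Submodule.add_mem _ hf hg

end OldStable

/-! ### Adjoints on `S_k(Γ₁(N))`: `T_p^* = [Γ₁(N) diag(p,1) Γ₁(N)] = T_p ⟨p⟩⁻¹` and `⟨d⟩^* = ⟨d⟩⁻¹`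
(Diamond–Shurman Prop. 5.5.2 and Thm. 5.5.3) -/

section Normaliser

variable (Γ : Subgroup (GL (Fin 2) ℝ)) [Γ.IsArithmetic] (k : ℤ)

/-- **Absorbing a right factor that normalises the level**: if `E = glCast e` normalises `Γ`, then
`[Γ (g e) Γ] f = ([Γ g Γ] f) ∣[k] E` as functions on `ℍ` (`Tr_Γ((f∣g)∣E) = (Tr_Γ(f∣g))∣E`, the
conjugation `r ↦ E⁻¹ r E` identifying the two index sets `Γ/(g⁻¹Γg ∩ Γ)` and
`Γ/((gE)⁻¹Γ(gE) ∩ Γ)`; the abstract form of Diamond–Shurman's computation in the proof of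
Thm. 5.5.3, p. 208: "`Γ₁(N) diag(p,1) Γ₁(N) = ⋃ Γ₁(N) β_j (p n; N m)`", i.e. right translation of
the representatives of `T_p` by an element of `Γ₀(N)`). [cite: DiamondShurman2005, proof of Thm. 5.5.3] -/
theorem coe_cuspHeckeOperator_mul_of_normaliser (g e : GL (Fin 2) ℚ)
    (hE : toConjAct (glCast e) • Γ = Γ) (f : CuspForm Γ k) :
    (⇑(cuspHeckeOperator Γ k (g * e) f) : ℍ → ℂ) =
      ⇑(cuspHeckeOperator Γ k g f) ∣[k] glCast e := by
  have hαE : glCast (g * e) = glCast g * glCast e := map_mul _ _ _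
  let 𝒢₁ : Subgroup (GL (Fin 2) ℝ) := toConjAct (glCast g)⁻¹ • Γ
  let 𝒢₂ : Subgroup (GL (Fin 2) ℝ) := toConjAct (glCast (g * e))⁻¹ • Γ
  letI := Fintype.ofFinite (Γ ⧸ 𝒢₁.subgroupOf Γ)
  letI := Fintype.ofFinite (Γ ⧸ 𝒢₂.subgroupOf Γ)
  have h𝒢₂ : 𝒢₂ = (toConjAct (glCast e))⁻¹ • 𝒢₁ := by
    change toConjAct (glCast (g * e))⁻¹ • Γ = (toConjAct (glCast e))⁻¹ • (toConjAct (glCast g)⁻¹ • Γ)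
    rw [hαE, mul_inv_rev, map_mul, mul_smul, map_inv]
  -- conjugation by `E` as an automorphism `c` of `Γ`, and the induced bijection `Γ/𝒢₂ ≃ Γ/𝒢₁`
  let c : Γ ≃* Γ := (Subgroup.equivSMul (toConjAct (glCast e)) Γ).trans (MulEquiv.subgroupCongr hE)
  have hc : ∀ h : Γ, ((c h : Γ) : GL (Fin 2) ℝ) = glCast e * h * (glCast e)⁻¹ := fun h ↦ by
    simp [c, toConjAct_smul]
  obtain ⟨eq, heq⟩ : ∃ eq : Γ ⧸ 𝒢₂.subgroupOf Γ ≃ Γ ⧸ 𝒢₁.subgroupOf Γ, ∀ r : Γ, eq ⟦r⟧ = ⟦c r⟧ := by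
    refine ⟨Quotient.congr c.toEquiv fun a b ↦ ?_, fun r ↦ rfl⟩
    rw [QuotientGroup.leftRel_apply, QuotientGroup.leftRel_apply, Subgroup.mem_subgroupOf,
      Subgroup.mem_subgroupOf]
    change _ ↔ (((c a)⁻¹ * c b : Γ) : GL (Fin 2) ℝ) ∈ 𝒢₁
    rw [← map_inv, ← map_mul, hc, ← toConjAct_smul, h𝒢₂, Subgroup.mem_inv_pointwise_smul_iff]
  simp only [cuspHeckeOperator, cuspHeckeCorrespondence, AddMonoidHom.coe_mk, ZeroHom.coe_mk,
    CuspForm.coe_trace, SlashAction.sum_slash]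
  symm
  rw [← Equiv.sum_comp eq]
  refine Fintype.sum_congr _ _ fun q ↦ ?_
  induction q using Quotient.inductionOn with
  | h r =>
    rw [heq, SlashInvariantForm.quotientFunc_mk, SlashInvariantForm.quotientFunc_mk,
      coe_cuspForm_translate, coe_cuspForm_translate, hc, hαE]
    simp only [← SlashAction.slash_mul]
    congr 1
    group

end Normaliser

section Adjoint

variable (N : ℕ) [NeZero N] (k : ℤ)

/-- `glCast (diagGL d 1) = tpD d = diag(d, 1)` in `GL(2, ℝ)`. [folklore] -/
theorem glCast_diagGL_one_eq_tpD (d : ℕ) [NeZero d] :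
    glCast (diagGL (d : ℚ) 1 (Nat.cast_pos.mpr (NeZero.pos d)) one_pos : GL (Fin 2) ℚ) = tpD d := by
  refine Units.ext ?_
  rw [val_glCast_diagGL, val_tpD]
  ext i j
  fin_cases i <;> fin_cases j <;> simp

/-- **Diamond–Shurman Thm. 5.5.3 on `Γ₁(N)`, operator form**: for a prime `p ∤ N` there is a unit
`u = p⁻¹` of `ℤ/Nℤ` with `[Γ₁(N) diag(p,1) Γ₁(N)] = T_p ∘ ⟨u⟩` on `S_k(Γ₁(N))` — together with the
adjointness `[Γ₁(N) diag(1,p) Γ₁(N)]^* = [Γ₁(N) diag(p,1) Γ₁(N)]` (Prop. 5.5.2(b),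
`cuspHeckeOperator_adjoint`) this is "`T_p^* = ⟨p⟩⁻¹ T_p`" (Thm. 5.5.3, p. 207). Proof as printed
(pp. 207–208): with `u p + v N = 1`, `diag(p,1) = (up, v; -N, 1) diag(1,p) (p, -v; N, u)`, the first
factor in `Γ₁(N)` (absorbed by `cuspHeckeCorrespondence_eq_of_eq_mul`) and the last in `Γ₀(N)`
with lower-right entry `u ≡ p⁻¹`, acting as `⟨u⟩` (`coe_cuspHeckeOperator_mul_of_normaliser`,
`coe_diamondOp_gamma0Map`); finally `T_p ⟨u⟩ = ⟨u⟩ T_p` (`heckeT_diamondOp_comm_holds`).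
[cite: DiamondShurman2005, Thm. 5.5.3 and its proof] -/
theorem exists_heckeTAdjoint_eq_heckeT_mul_diamondOp (p : ℕ) [NeZero p] (hp : p.Prime)
    (hpN : ¬ p ∣ N) :
    ∃ u : ZMod N, u * p = 1 ∧
      cuspHeckeOperatorₗ (Gamma1 N) k (diagGL p 1 (Nat.cast_pos.mpr (NeZero.pos p)) one_pos) =
        heckeT (Gamma1 N) k p * diamondOp N k u := by
  obtain ⟨u, v, huv⟩ : IsCoprime (p : ℤ) (N : ℤ) :=
    Nat.isCoprime_iff_coprime.mpr ((Nat.Prime.coprime_iff_not_dvd hp).mpr hpN)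
  -- the matrices `γ = (up, v; -N, 1) ∈ Γ₁(N)` and `δ = (p, -v; N, u) ∈ Γ₀(N)`
  let γ : SL(2, ℤ) := ⟨!![u * p, v; -N, 1], by
    rw [Matrix.det_fin_two_of]; linear_combination huv⟩
  let δ : SL(2, ℤ) := ⟨!![p, -v; N, u], by
    rw [Matrix.det_fin_two_of]; linear_combination huv⟩
  have hγ : γ ∈ Gamma1 N := by
    rw [Gamma1_mem]
    refine ⟨?_, by simp [γ], by simp [γ]⟩
    have : ((u * p : ℤ) : ZMod N) = 1 - v * N := by
      rw [← Int.cast_one (R := ZMod N), ← huv]; push_cast; ring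
    simp [γ, this]
  have hδ : δ ∈ Gamma0 N := by simp [Gamma0_mem, δ]
  set D : GL (Fin 2) ℚ := (diagGL p 1 (Nat.cast_pos.mpr (NeZero.pos p)) one_pos : GL (Fin 2) ℚ)
    with hD
  set D' : GL (Fin 2) ℚ := (diagGL 1 p one_pos (Nat.cast_pos.mpr (NeZero.pos p)) : GL (Fin 2) ℚ)
    with hD'
  -- `diag(p,1) = γ diag(1,p) δ`
  have hmul : glCast (D' * (slToGLPos δ : GL (Fin 2) ℚ)) = glCast D' * mapGL ℝ δ := by
    rw [← glCast_slToGLPos]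
    exact map_mul (Matrix.GeneralLinearGroup.map (Rat.castHom ℝ)) _ _
  have hmat : glCast D = mapGL ℝ γ * glCast (D' * (slToGLPos δ : GL (Fin 2) ℚ)) * 1 := by
    rw [mul_one, hmul, hD, hD']
    refine Matrix.GeneralLinearGroup.ext fun i j ↦ ?_
    have huv' : (u : ℝ) * p + v * N = 1 := by exact_mod_cast huv
    simp only [Matrix.GeneralLinearGroup.coe_mul, Matrix.SpecialLinearGroup.mapGL_coe_matrix, glCast,
      γ, δ]
    fin_cases i <;> fin_cases j <;> simp [Matrix.mul_apply, Fin.sum_univ_two, diagGL] <;>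
      first | ring1 | linear_combination (-(p : ℝ)) * huv' | linear_combination (-1 : ℝ) * huv'
  refine ⟨(u : ZMod N), ?_, ?_⟩
  · have h := congrArg (fun z : ℤ ↦ (z : ZMod N)) huv
    simp only [Int.cast_add, Int.cast_mul, Int.cast_natCast, ZMod.natCast_self, mul_zero, add_zero,
      Int.cast_one] at h
    exact h
  apply LinearMap.ext fun f ↦ ?_
  have hu : Gamma0Map N ⟨δ, hδ⟩ = (u : ZMod N) := by
    rw [gamma0Map_eq_intCast]
    simp [δ]
  have hcomm : (heckeT (Gamma1 N) k p * diamondOp N k (u : ZMod N)) f =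
      diamondOp N k (u : ZMod N) (heckeT (Gamma1 N) k p f) := by
    rw [heckeT_diamondOp_comm_holds N k p (u : ZMod N), Module.End.mul_apply]
  rw [hcomm]
  apply DFunLike.coe_injective
  rw [← hu, coe_diamondOp_gamma0Map]
  change ⇑(cuspHeckeCorrespondence _ _ k D f) = ⇑(cuspHeckeCorrespondence _ _ k D' f) ∣[k] _
  rw [cuspHeckeCorrespondence_eq_of_eq_mul (Gamma1 N) (Gamma1 N) k
    (Subgroup.mem_map_of_mem _ hγ) (one_mem _) hmat, ← glCast_slToGLPos]
  exact coe_cuspHeckeOperator_mul_of_normaliser (Gamma1 N) k D' (slToGLPos δ : GL (Fin 2) ℚ)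
    (by rw [glCast_slToGLPos]; exact conj_Gamma1_eq N hδ) f

/-- **Adjointness of `T_p` on `S_k(Γ₁(N))`** (Diamond–Shurman Prop. 5.5.2(b) with `α = diag(1,p)`,
`α' = diag(p,1)`): `⟨T_p f, g⟩ = ⟨f, [Γ₁(N) diag(p,1) Γ₁(N)] g⟩` for the Petersson product, every
`p ≥ 1`. [cite: DiamondShurman2005, Prop. 5.5.2(b)] -/
theorem peterssonProduct_heckeT_left_gamma1 (p : ℕ) [NeZero p] (f g : CuspForm (Gamma1 N) k) :
    peterssonProduct (Gamma1 N) k (heckeT (Gamma1 N) k p f) g =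
      peterssonProduct (Gamma1 N) k f
        (cuspHeckeOperatorₗ (Gamma1 N) k (diagGL p 1 (Nat.cast_pos.mpr (NeZero.pos p)) one_pos) g) :=
  cuspHeckeOperator_adjoint (Gamma1 N) (Subgroup.map_le_range _ _) k
    (diagGL 1 p one_pos (Nat.cast_pos.mpr (NeZero.pos p)))
    (diagGL p 1 (Nat.cast_pos.mpr (NeZero.pos p)) one_pos)
    (coe_coe_diagGL_eq_adjugate 1 p one_pos (Nat.cast_pos.mpr (NeZero.pos p))) f g

/-- The converse adjointness: `⟨[Γ₁(N) diag(p,1) Γ₁(N)] f, g⟩ = ⟨f, T_p g⟩` (Diamond–Shurman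
Prop. 5.5.2(b) with `α = diag(p,1)`, `α' = diag(1,p)`). [cite: DiamondShurman2005, Prop. 5.5.2(b)] -/
theorem peterssonProduct_heckeTAdjoint_left_gamma1 (p : ℕ) [NeZero p] (f g : CuspForm (Gamma1 N) k) :
    peterssonProduct (Gamma1 N) k
        (cuspHeckeOperatorₗ (Gamma1 N) k (diagGL p 1 (Nat.cast_pos.mpr (NeZero.pos p)) one_pos) f) g =
      peterssonProduct (Gamma1 N) k f (heckeT (Gamma1 N) k p g) :=
  cuspHeckeOperator_adjoint (Gamma1 N) (Subgroup.map_le_range _ _) k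
    (diagGL p 1 (Nat.cast_pos.mpr (NeZero.pos p)) one_pos)
    (diagGL 1 p one_pos (Nat.cast_pos.mpr (NeZero.pos p)))
    (coe_coe_diagGL_eq_adjugate p 1 (Nat.cast_pos.mpr (NeZero.pos p)) one_pos) f g

/-- `⟨d⟩ = [Γ₁(N) σ Γ₁(N)]` for *any* `σ ∈ Γ₀(N)` above the unit `d` (Diamond–Shurman §5.2, p. 168;
the definition of `diamondOp` makes a choice, immaterial by `coe_diamondOp_gamma0Map`). [cite: DiamondShurman2005, §5.2 p. 168] -/
theorem diamondOp_eq_cuspHeckeOperatorₗ (σ : Gamma0 N) :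
    diamondOp N k (Gamma0Map N σ) = cuspHeckeOperatorₗ (Gamma1 N) k (slToGLPos (σ : SL(2, ℤ))) := by
  apply LinearMap.ext fun f ↦ ?_
  apply DFunLike.coe_injective
  rw [coe_diamondOp_gamma0Map, coe_cuspHeckeOperatorₗ_gamma1]

/-- The matrix of `σ⁻¹` is the adjugate of that of `σ` for `σ ∈ SL(2, ℤ)` (viewed in `GL(2, ℚ)⁺`),
i.e. `σ⁻¹` is Diamond–Shurman's `σ' = det(σ) σ⁻¹`. [folklore] -/
theorem coe_coe_slToGLPos_inv_eq_adjugate (σ : SL(2, ℤ)) :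
    ((slToGLPos σ⁻¹ : GL (Fin 2) ℚ) : Matrix (Fin 2) (Fin 2) ℚ) =
      ((slToGLPos σ : GL (Fin 2) ℚ) : Matrix (Fin 2) (Fin 2) ℚ).adjugate := by
  have h1 : ∀ τ : SL(2, ℤ), ((slToGLPos τ : GL (Fin 2) ℚ) : Matrix (Fin 2) (Fin 2) ℚ) =
      (τ : Matrix (Fin 2) (Fin 2) ℤ).map (Int.castRingHom ℚ) := fun τ ↦ rfl
  rw [h1, h1, Matrix.SpecialLinearGroup.coe_inv, Matrix.adjugate_fin_two, Matrix.adjugate_fin_two]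
  ext i j
  fin_cases i <;> fin_cases j <;> simp

/-- **`⟨d⟩^* = ⟨d⟩⁻¹` on `S_k(Γ₁(N))`** (Diamond–Shurman Thm. 5.5.3: "`⟨p⟩^* = ⟨p⟩⁻¹`"; from
Prop. 5.5.2(b) with `α = σ ∈ Γ₀(N)` above `d`, `α' = σ⁻¹`): `⟨⟨d⟩ f, g⟩ = ⟨f, ⟨d⁻¹⟩ g⟩` for every
unit `d`. [cite: DiamondShurman2005, Thm. 5.5.3] -/
theorem peterssonProduct_diamondOp_left (d : (ZMod N)ˣ) (f g : CuspForm (Gamma1 N) k) :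
    peterssonProduct (Gamma1 N) k (diamondOp N k (d : ZMod N) f) g =
      peterssonProduct (Gamma1 N) k f (diamondOp N k (d⁻¹ : (ZMod N)ˣ) g) := by
  obtain ⟨σ, hσ⟩ := exists_gamma0Map_eq_holds N d.isUnit
  have hσ' : Gamma0Map N σ⁻¹ = ((d⁻¹ : (ZMod N)ˣ) : ZMod N) := by
    symm
    apply Units.inv_eq_of_mul_eq_one_left
    rw [← hσ, ← map_mul, inv_mul_cancel, map_one]
  rw [← hσ, ← hσ', diamondOp_eq_cuspHeckeOperatorₗ, diamondOp_eq_cuspHeckeOperatorₗ]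
  exact cuspHeckeOperator_adjoint (Gamma1 N) (Subgroup.map_le_range _ _) k
    (slToGLPos (σ : SL(2, ℤ))) (slToGLPos ((σ⁻¹ : Gamma0 N) : SL(2, ℤ)))
    (by rw [InvMemClass.coe_inv]; exact coe_coe_slToGLPos_inv_eq_adjugate _) f g

end Adjoint

/-! ### `U_p^* = w_N U_p w_N⁻¹` on `S_k(Γ₁(N))` and `w_N` preserves the old subspace -/

section Fricke

variable (N : ℕ) [NeZero N] (k : ℤ)

/-- **`w_N T_p w_N = (-1)^k [Γ₁(N) diag(p,1) Γ₁(N)]` on `S_k(Γ₁(N))`** for every `p ≥ 1`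
(Diamond–Shurman Ex. 5.5.1(b),(c): `T^* = w_N T w_N⁻¹` for every Hecke operator, via
`w_N⁻¹ diag(1,p) w_N = diag(p,1)`: conjugating coset representatives of `Γ₁(N) diag(1,p) Γ₁(N)` by
`w_N` gives representatives of `Γ₁(N) diag(p,1) Γ₁(N)`; and `w_N² = (-1)^k`,
`frickeInvolution1_frickeInvolution1`). The `Γ₀(N)` twin is
`frickeInvolution_heckeT_frickeInvolution`. [cite: DiamondShurman2005, Ex. 5.5.1] -/
theorem frickeInvolution1_heckeT_frickeInvolution1 (p : ℕ) [NeZero p] (g : CuspForm (Gamma1 N) k) :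
    frickeInvolution1 N k (heckeT (Gamma1 N) k p (frickeInvolution1 N k g)) =
      ((-1 : ℂ) ^ k) • cuspHeckeOperatorₗ (Gamma1 N) k
        (diagGL p 1 (Nat.cast_pos.mpr (NeZero.pos p)) one_pos) g := by
  set w := glCast (frickeGL N : GL (Fin 2) ℚ) with hw
  set D' : GL (Fin 2) ℚ := (diagGL 1 p one_pos (Nat.cast_pos.mpr (NeZero.pos p)) : GL (Fin 2) ℚ)
    with hD'
  set D : GL (Fin 2) ℚ := (diagGL p 1 (Nat.cast_pos.mpr (NeZero.pos p)) one_pos : GL (Fin 2) ℚ)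
    with hD
  letI := Fintype.ofFinite ((Gamma1 N : Subgroup (GL (Fin 2) ℝ)) ⧸
    (ConjAct.toConjAct (glCast D')⁻¹ • (Gamma1 N : Subgroup (GL (Fin 2) ℝ))).subgroupOf (Gamma1 N))
  obtain ⟨m, α, hα⟩ := exists_isDoubleCosetDecomp (Gamma1 N : Subgroup (GL (Fin 2) ℝ))
    (Gamma1 N) (glCast D')
  have hβ : IsDoubleCosetDecomp (Gamma1 N : Subgroup (GL (Fin 2) ℝ)) (Gamma1 N) (glCast D)
      (fun i ↦ w⁻¹ * α i * w) := by
    have h := hα.inv_mul_mul (u := w) (fun γ hγ ↦ frickeGL_mul_mul_inv_mem_gamma1 N hγ)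
      (fun γ hγ ↦ by rw [hw, frickeGL_inv_mul_mul_eq]; exact frickeGL_mul_mul_inv_mem_gamma1 N hγ)
    rwa [hw, hD', frickeGL_inv_mul_diagGL_mul, ← hD, ← hw] at h
  -- the cusp form `F = [Γ₁(N) diag(p,1) Γ₁(N)] g` and `w_N (w_N F) = (-1)^k F`
  set F : CuspForm (Gamma1 N) k := cuspHeckeOperatorₗ (Gamma1 N) k
    (diagGL p 1 (Nat.cast_pos.mpr (NeZero.pos p)) one_pos) g with hF
  have hfr := frickeInvolution1_apply_eq_slash N k
  have eF : (⇑F : ℍ → ℂ) = ∑ i, ⇑g ∣[k] (w⁻¹ * α i * w) :=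
    coe_cuspHeckeCorrespondence_eq_sum _ _ k D hβ g
  have eT : (⇑(heckeT (Gamma1 N) k p (frickeInvolution1 N k g)) : ℍ → ℂ) =
      ∑ i, ⇑(frickeInvolution1 N k g) ∣[k] α i :=
    coe_cuspHeckeCorrespondence_eq_sum _ _ k D' hα _
  have hwwF := congrArg (fun G : CuspForm (Gamma1 N) k ↦ (⇑G : ℍ → ℂ))
    (frickeInvolution1_frickeInvolution1 N k F)
  rw [hfr, hfr F, ModularForm.smul_slash, σ_ofReal, ← SlashAction.slash_mul,
    CuspForm.IsGLPos.coe_smul] at hwwF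
  -- `w_N (T_p (w_N g))` as a function
  apply DFunLike.coe_injective
  rw [CuspForm.IsGLPos.coe_smul, ← hwwF, hfr, eT, hfr g, eF]
  simp only [SlashAction.sum_slash, ModularForm.smul_slash, σ_ofReal, ← SlashAction.slash_mul,
    Finset.smul_sum]
  refine Finset.sum_congr rfl fun i _ ↦ ?_
  rw [← hw, show w⁻¹ * α i * w * (w * w) = w * α i * w by
    rw [frickeGL_inv_mul_mul_eq N (α i), ← hw]; group]

/-- **`w_N` maps `d`-old forms from level `M` to `d'`-old forms**, `M d d' = N`: for
`g ∈ S_k(Γ₁(M))`, `c_M • w_N ([α_d]_k g) = (c_N d^{k-2}) • [α_{d'}]_k (w_M g)`, where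
`c_L = L^{1-k/2}` is the normalising constant of `frickeInvolution1 L k` (so, up to units,
`w_N [α_d] = [α_{d'}] w_M`; Diamond–Shurman Prop. 5.6.2, third diagram; Atkin–Lehner 1970,
Lemma 26; the matrix identity `diag(d,1) w_N = (d·1) w_M diag(d',1)` is `tpD_mul_frickeGL_eq`).
[cite: DiamondShurman2005, Prop. 5.6.2 (proof, third diagram)] -/
theorem frickeInvolution1_degeneracyMap1_smul_eq {M d d' : ℕ} [NeZero M] [NeZero d] [NeZero d']
    (h : M * d * d' = N) (hd : M * d ∣ N) (hd' : M * d' ∣ N) (g : CuspForm (Gamma1 M) k) :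
    ((((M : ℝ) ^ (1 - (k : ℝ) / 2) : ℝ) : ℂ)) • frickeInvolution1 N k (degeneracyMap1 M N d k g) =
      ((((N : ℝ) ^ (1 - (k : ℝ) / 2) : ℝ) : ℂ) * (((d : ℝ) ^ (k - 2) : ℝ) : ℂ)) •
        degeneracyMap1 M N d' k (frickeInvolution1 M k g) := by
  apply DFunLike.coe_injective
  have hσd : ∀ c : ℂ, σ (tpD d') c = c := fun c ↦
    σ_eq_self (by rw [det_tpD]; exact_mod_cast NeZero.pos d') c
  rw [CuspForm.IsGLPos.coe_smul, CuspForm.IsGLPos.coe_smul, frickeInvolution1_apply_eq_slash N k,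
    coe_degeneracyMap1_eq_slash M N d k hd, coe_degeneracyMap1_eq_slash M N d' k hd',
    frickeInvolution1_apply_eq_slash M k, glCast_diagGL_one_eq_tpD, glCast_diagGL_one_eq_tpD,
    ← SlashAction.slash_mul, tpD_mul_frickeGL_eq N h, SlashAction.slash_mul, SlashAction.slash_mul,
    slash_diagGL_self, ModularForm.smul_slash, σ_glCast, ModularForm.smul_slash, hσd,
    ModularForm.smul_slash, hσd]
  simp only [smul_smul]
  ring_nf

/-- **The Fricke involution preserves the old subspace `S_k(Γ₁(N))^{old}`** (Diamond–Shurman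
Prop. 5.6.2, proof: "it suffices to show that the oldforms are preserved under the injective linear
map `w`", third diagram): on a generator `[α_d]_k g` of the old subspace, `w_N` gives a multiple of
`[α_{d'}]_k (w_M g)`, `d d' = N / M` (`frickeInvolution1_degeneracyMap1_smul_eq`), which is old.
[cite: DiamondShurman2005, Prop. 5.6.2] -/
theorem frickeInvolution1_mem_oldSubspace1 {f : CuspForm (Gamma1 N) k} (hf : f ∈ oldSubspace1 N k) :
    frickeInvolution1 N k f ∈ oldSubspace1 N k := by
  have hf' : f ∈ ⨆ Md : DegeneracyIndex N, LinearMap.range (degeneracyMap1 Md.1.1 N Md.1.2 k) := hf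
  refine Submodule.iSup_induction _
    (motive := fun f ↦ frickeInvolution1 N k f ∈ oldSubspace1 N k) hf' ?_ ?_ ?_
  · rintro ⟨⟨M, d⟩, hM, hMd⟩ f hf''
    obtain ⟨g, rfl⟩ := LinearMap.mem_range.mp hf''
    dsimp only at g hMd ⊢
    haveI hM0 : NeZero M := ⟨(Nat.pos_of_mem_properDivisors hM).ne'⟩
    haveI hd0 : NeZero d := ⟨fun hd ↦ NeZero.ne N (Nat.eq_zero_of_zero_dvd (by simpa [hd] using hMd))⟩
    obtain ⟨d', hd'⟩ := hMd
    haveI hd'0 : NeZero d' := ⟨fun h0 ↦ NeZero.ne N (by rw [hd', h0, mul_zero])⟩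
    have hMd : M * d ∣ N := ⟨d', hd'⟩
    have hMd' : M * d' ∣ N := ⟨d, by rw [hd']; ring⟩
    have hc : ((((M : ℝ) ^ (1 - (k : ℝ) / 2) : ℝ) : ℂ)) ≠ 0 :=
      Complex.ofReal_ne_zero.mpr (Real.rpow_pos_of_pos (by exact_mod_cast NeZero.pos M) _).ne'
    have key := frickeInvolution1_degeneracyMap1_smul_eq N k hd'.symm hMd hMd' g
    rw [← inv_smul_smul₀ hc (frickeInvolution1 N k (degeneracyMap1 M N d k g)), key]
    exact Submodule.smul_mem _ _ (Submodule.smul_mem _ _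
      (range_degeneracyMap1_le_oldSubspace1 N k hM hMd' (LinearMap.mem_range_self _ _)))
  · rw [map_zero]
    exact Submodule.zero_mem _
  · intro f g hf hg
    rw [map_add]
    exact Submodule.add_mem _ hf hg

end Fricke

/-! ### The new subspace of `S_k(Γ₁(N))` is stable under the `T_p` and the `⟨d⟩`
(Diamond–Shurman Prop. 5.6.2, new half) -/

section NewStable

variable (N : ℕ) [NeZero N] (k : ℤ)

/-- New forms are Petersson-orthogonal to old forms on `Γ₁(N)` (Li 1975, Thm. 3 with Lemma 5;
`newSubspace1_le_orthogonal_oldSubspace1`). [cite: Li1975, Thm. 3 with Lemma 5] -/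
theorem peterssonProduct_eq_zero_of_mem_newSubspace1_of_mem_oldSubspace1 {f g : CuspForm (Gamma1 N) k}
    (hf : f ∈ newSubspace1 N k) (hg : g ∈ oldSubspace1 N k) :
    peterssonProduct (Gamma1 N) k f g = 0 :=
  newSubspace1_le_orthogonal_oldSubspace1 N k hf g hg

/-- **The new subspace `S_k(Γ₁(N))^{new}` is stable under `T_p` for every prime `p`**
(Diamond–Shurman Prop. 5.6.2, new half; for `p ∣ N` the operator is `U_p`). As printed (p. 210):
it suffices that the old subspace is stable under the adjoint of `T_p`; the Petersson adjoint of
`T_p = [Γ₁(N) diag(1,p) Γ₁(N)]` is `[Γ₁(N) diag(p,1) Γ₁(N)]` (Prop. 5.5.2(b),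
`peterssonProduct_heckeT_left_gamma1`) `= (-1)^k w_N T_p w_N`
(`frickeInvolution1_heckeT_frickeInvolution1`, Ex. 5.5.1), and the old subspace is stable under `T_p`
(`heckeT_mem_oldSubspace1`) and under `w_N` (`frickeInvolution1_mem_oldSubspace1`). So for `f` new
and `g` old, `⟨g, T_p f⟩ = conj ⟨T_p f, g⟩ = conj ((-1)^k ⟨f, w_N T_p w_N g⟩) = 0`, and a form
right-orthogonal to the old subspace is new (`mem_newSubspace1_of_forall_peterssonProduct_eq_zero`).
[cite: DiamondShurman2005, Prop. 5.6.2] -/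
theorem heckeT_mem_newSubspace1 {p : ℕ} [NeZero p] (hp : p.Prime) {f : CuspForm (Gamma1 N) k}
    (hf : f ∈ newSubspace1 N k) : heckeT (Gamma1 N) k p f ∈ newSubspace1 N k := by
  refine mem_newSubspace1_of_forall_peterssonProduct_eq_zero N k fun g hg ↦ ?_
  have hk : ((-1 : ℂ) ^ k) * ((-1 : ℂ) ^ k) = 1 := by
    rw [← mul_zpow, neg_one_mul, neg_neg, one_zpow]
  have hU : cuspHeckeOperatorₗ (Gamma1 N) k (diagGL p 1 (Nat.cast_pos.mpr (NeZero.pos p)) one_pos) g =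
      ((-1 : ℂ) ^ k) • frickeInvolution1 N k (heckeT (Gamma1 N) k p (frickeInvolution1 N k g)) := by
    rw [frickeInvolution1_heckeT_frickeInvolution1, smul_smul, hk, one_smul]
  have hold : frickeInvolution1 N k (heckeT (Gamma1 N) k p (frickeInvolution1 N k g)) ∈
      oldSubspace1 N k :=
    frickeInvolution1_mem_oldSubspace1 N k
      (heckeT_mem_oldSubspace1 N k hp (frickeInvolution1_mem_oldSubspace1 N k hg))
  rw [peterssonProduct_conj_symm_holds (Gamma1 N) k (heckeT (Gamma1 N) k p f) g,
    peterssonProduct_heckeT_left_gamma1, hU, peterssonProduct_smul_right,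
    peterssonProduct_eq_zero_of_mem_newSubspace1_of_mem_oldSubspace1 N k hf hold, mul_zero, map_zero]

/-- **The new subspace `S_k(Γ₁(N))^{new}` is stable under the diamond operators** (Diamond–Shurman
Prop. 5.6.2, new half, `T = ⟨d⟩`: "`⟨n⟩^* = ⟨n⟩⁻¹` … the result is clear in these cases"): for `f`
new, `g` old and a unit `d`, `⟨g, ⟨d⟩ f⟩ = conj ⟨⟨d⟩ f, g⟩ = conj ⟨f, ⟨d⁻¹⟩ g⟩ = 0` since
`⟨d⁻¹⟩ g` is old (`diamondOp_mem_oldSubspace1`); for a non-unit `d`, `⟨d⟩` is the identity (junk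
value). [cite: DiamondShurman2005, Prop. 5.6.2] -/
theorem diamondOp_mem_newSubspace1 (d : ZMod N) {f : CuspForm (Gamma1 N) k}
    (hf : f ∈ newSubspace1 N k) : diamondOp N k d f ∈ newSubspace1 N k := by
  by_cases hd : IsUnit d
  swap
  · rwa [diamondOp_of_not_isUnit hd, LinearMap.id_apply]
  obtain ⟨u, rfl⟩ := hd
  refine mem_newSubspace1_of_forall_peterssonProduct_eq_zero N k fun g hg ↦ ?_
  rw [peterssonProduct_conj_symm_holds (Gamma1 N) k (diamondOp N k (u : ZMod N) f) g,
    peterssonProduct_diamondOp_left,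
    peterssonProduct_eq_zero_of_mem_newSubspace1_of_mem_oldSubspace1 N k hf
      (diamondOp_mem_oldSubspace1 N k _ hg), map_zero]

/-- The adjoint `[Γ₁(N) diag(p,1) Γ₁(N)]` of `T_p` also preserves the new subspace (its own adjoint
is `T_p`, `peterssonProduct_heckeTAdjoint_left_gamma1`, which preserves the old subspace). [cite: DiamondShurman2005, Prop. 5.6.2] -/
theorem heckeTAdjoint_mem_newSubspace1 {p : ℕ} [NeZero p] (hp : p.Prime) {f : CuspForm (Gamma1 N) k}
    (hf : f ∈ newSubspace1 N k) :
    cuspHeckeOperatorₗ (Gamma1 N) k (diagGL p 1 (Nat.cast_pos.mpr (NeZero.pos p)) one_pos) f ∈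
      newSubspace1 N k := by
  refine mem_newSubspace1_of_forall_peterssonProduct_eq_zero N k fun g hg ↦ ?_
  rw [peterssonProduct_conj_symm_holds (Gamma1 N) k _ g, peterssonProduct_heckeTAdjoint_left_gamma1,
    peterssonProduct_eq_zero_of_mem_newSubspace1_of_mem_oldSubspace1 N k hf
      (heckeT_mem_oldSubspace1 N k hp hg), map_zero]

end NewStable


/-! ### Normal operators for a definite Hermitian form have semisimple eigenvalues -/

section Normal

variable {W : Type*} [AddCommGroup W] [Module ℂ W]

/-- **No Jordan blocks for normal operators.** Let `B` be a form on a complex vector space which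
is additive and homogeneous in the second variable, Hermitian (`B w v = conj (B v w)`) and definite
(`B v v = 0 → v = 0`); let `T` have a `B`-adjoint `T'` (`B (T v) w = B v (T' w)`) commuting with
`T` (a *normal* operator). Then `(T - μ)² w = 0` implies `(T - μ) w = 0`: with `S = T - μ`,
`S' = T' - conj μ` one has `B (S v) (S v) = B v (S' S v) = B v (S S' v) = B (S' v) (S' v)`, so
`ker S = ker S'`; hence `S² w = 0` gives `S' (S w) = 0` and `B (S w) (S w) = B w (S' S w) = 0`
(standard linear algebra; the mechanism of Diamond–Shurman Thm. 5.5.4, "a commuting family of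
normal operators … has an orthogonal basis of simultaneous eigenvectors", applied to `T_p`, `⟨d⟩` on
`S_k(Γ₁(N))`, Thm. 5.5.3: "the Hecke operators `⟨n⟩` and `T_n` for `n` relatively prime to `N` are
normal"). [folklore] -/
theorem apply_eq_zero_of_sq_apply_eq_zero_of_normal (B : W → W → ℂ)
    (add_right : ∀ u v w, B u (v + w) = B u v + B u w)
    (smul_right : ∀ (c : ℂ) (v w : W), B v (c • w) = c * B v w)
    (conj_symm : ∀ v w, B w v = conj (B v w)) (definite : ∀ v, B v v = 0 → v = 0)
    (T T' : Module.End ℂ W) (hT : ∀ v w, B (T v) w = B v (T' w)) (hTT' : T * T' = T' * T)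
    (μ : ℂ) (w : W) (h : (T - μ • 1) ((T - μ • 1) w) = 0) : (T - μ • 1) w = 0 := by
  -- derived rules
  have smul_left : ∀ (c : ℂ) (v w : W), B (c • v) w = conj c * B v w := fun c v w ↦ by
    rw [conj_symm, smul_right, map_mul, ← conj_symm]
  have sub_right : ∀ u v w, B u (v - w) = B u v - B u w := fun u v w ↦ by
    rw [eq_sub_iff_add_eq, ← add_right, sub_add_cancel]
  have sub_left : ∀ u v w, B (u - v) w = B u w - B v w := fun u v w ↦ by
    rw [conj_symm, sub_right, map_sub, ← conj_symm, ← conj_symm]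
  have zero_right : ∀ u, B u 0 = 0 := fun u ↦ by
    have := add_right u 0 0
    rw [add_zero] at this
    linear_combination -this
  set S : Module.End ℂ W := T - μ • 1 with hS
  set S' : Module.End ℂ W := T' - conj μ • 1 with hS'
  -- `S` and `S'` are adjoint and commute
  have hadj : ∀ v w, B (S v) w = B v (S' w) := fun v w ↦ by
    simp only [hS, hS', LinearMap.sub_apply, LinearMap.smul_apply, Module.End.one_apply]
    rw [sub_left, smul_left, hT, sub_right, smul_right]
  have hadj' : ∀ v w, B (S' v) w = B v (S w) := fun v w ↦ by
    rw [conj_symm, ← hadj, ← conj_symm]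
  have hcomm : ∀ v, S (S' v) = S' (S v) := fun v ↦ by
    have h1 : T (T' v) = T' (T v) := by
      simpa only [Module.End.mul_apply] using LinearMap.congr_fun hTT' v
    simp only [hS, hS', LinearMap.sub_apply, LinearMap.smul_apply, Module.End.one_apply, map_sub,
      map_smul, h1]
    module
  -- `B (S v) (S v) = B (S' v) (S' v)`, so `S v = 0 ↔ S' v = 0`
  have hker : ∀ v, S v = 0 → S' v = 0 := fun v hv ↦ by
    apply definite
    rw [hadj', hcomm, ← hadj, hv, zero_right]
  -- conclude
  apply definite
  rw [hadj, hker _ h, zero_right]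

/-- **Generalised eigenspaces of a normal operator are eigenspaces**: for `B`, `T`, `T'` as in
`apply_eq_zero_of_sq_apply_eq_zero_of_normal` and every `μ ∈ ℂ`, `⋃ₙ ker (T - μ)ⁿ = ker (T - μ)`
(induction on `n`). The linear algebra that turns the joint *generalised* eigenspaces of the
commuting normal family `{T_p, ⟨d⟩ : p ∤ N}` on `S_k(Γ₁(N))^{new}` into joint eigenspaces
(Diamond–Shurman Thm. 5.5.4 and Cor. 5.6.3: `S_k(Γ₁(N))^{new}` "has an orthogonal basis of
eigenforms for the Hecke operators away from the level"). [folklore] -/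
theorem maxGenEigenspace_eq_eigenspace_of_normal (B : W → W → ℂ)
    (add_right : ∀ u v w, B u (v + w) = B u v + B u w)
    (smul_right : ∀ (c : ℂ) (v w : W), B v (c • w) = c * B v w)
    (conj_symm : ∀ v w, B w v = conj (B v w)) (definite : ∀ v, B v v = 0 → v = 0)
    (T T' : Module.End ℂ W) (hT : ∀ v w, B (T v) w = B v (T' w)) (hTT' : T * T' = T' * T)
    (μ : ℂ) : T.maxGenEigenspace μ = T.eigenspace μ := by
  refine le_antisymm (fun v hv ↦ ?_) Module.End.eigenspace_le_maxGenEigenspace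
  rw [Module.End.mem_maxGenEigenspace] at hv
  obtain ⟨n, hn⟩ := hv
  rw [Module.End.eigenspace_def, LinearMap.mem_ker]
  induction n generalizing v with
  | zero =>
    rw [pow_zero, Module.End.one_apply] at hn
    rw [hn, map_zero]
  | succ n ih =>
    rw [pow_succ, Module.End.mul_apply] at hn
    exact apply_eq_zero_of_sq_apply_eq_zero_of_normal B add_right smul_right conj_symm definite
      T T' hT hTT' μ v (ih _ hn)

end Normal

/-! ### Coefficients of eigenforms away from the level (Diamond–Shurman (5.21)) -/

section Coeff

variable {N : ℕ} [NeZero N] {k : ℤ}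

/-- **An eigenform away from `N` with `a₁ = 0` has `a_n = 0` for all `(n, N) = 1`** (Diamond–Shurman,
proof of Thm. 5.8.2, PDF p. 217: "`a_n(f) = c_n a_1(f)` when `(n, N) = 1`. Thus if `a₁(f) = 0` then
`a_n(f) = 0` when `(n, N) = 1`"). Here `f ∈ S_k(Γ₁(N))` is a `T_p`-eigenform for the primes `p ∤ N`
and an eigenform of the diamond operators; instead of the operators `T_n` for composite `n` (not in
the tree) the proof is the induction on `n` through the `q`-expansion formula
`a_{pm}(f) = a_m(T_p f) - p^{k-1} 𝟙_{p∣m} a_{m/p}(⟨p⟩ f)` (Prop. 5.2.2(a),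
`qExpansion_coeff_heckeT_gamma1_holds`). [cite: DiamondShurman2005, Thm. 5.8.2 (proof), (5.21)] -/
theorem cuspCoeff_eq_zero_of_coprime_gamma1 (f : CuspForm (Gamma1 N) k) (a : ℕ → ℂ)
    (hT : ∀ (p : ℕ) (hp : p.Prime), ¬ p ∣ N →
      (haveI : NeZero p := ⟨hp.ne_zero⟩; heckeT (Gamma1 N) k p f) = a p • f)
    (hD : ∀ d : (ZMod N)ˣ, ∃ c : ℂ, diamondOp N k (d : ZMod N) f = c • f)
    (h1 : cuspCoeff f 1 = 0) :
    ∀ n : ℕ, 0 < n → n.Coprime N → cuspCoeff f n = 0 := by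
  intro n
  induction n using Nat.strong_induction_on with
  | _ n ih =>
    intro hn0 hcop
    rcases Nat.lt_or_ge 1 n with h1n | hn1
    · -- `n > 1`: split off the least prime factor `p`, `n = p m`
      have hp : n.minFac.Prime := Nat.minFac_prime h1n.ne'
      obtain ⟨m, hm⟩ : n.minFac ∣ n := Nat.minFac_dvd n
      set p := n.minFac with hp_def
      haveI : NeZero p := ⟨hp.ne_zero⟩
      rw [hm] at hn0 hcop ⊢
      have hm0 : 0 < m := Nat.pos_of_mul_pos_left hn0
      have hcopp : p.Coprime N := Nat.Coprime.coprime_dvd_left (dvd_mul_right p m) hcop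
      have hpN : ¬ p ∣ N := (Nat.Prime.coprime_iff_not_dvd hp).mp hcopp
      have hmcop : m.Coprime N := Nat.Coprime.coprime_dvd_left (dvd_mul_left m p) hcop
      have hmlt : m < p * m := lt_mul_of_one_lt_left hm0 hp.one_lt
      have hmn : m < n := by rw [hm]; exact hmlt
      have ham : cuspCoeff f m = 0 := ih m hmn hm0 hmcop
      have key := cuspCoeff_heckeT_gamma1 f p hp m
      rw [hT p hp hpN, cuspCoeff_smul_gamma1, ham, mul_zero, if_neg hpN] at key
      by_cases hpm : p ∣ m
      · obtain ⟨c, hc⟩ := hD (ZMod.unitOfCoprime p hcopp)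
        rw [ZMod.coe_unitOfCoprime] at hc
        have hdivn : m / p < n := (Nat.div_le_self m p).trans_lt hmn
        have hdiv0 : 0 < m / p := Nat.div_pos (Nat.le_of_dvd hm0 hpm) hp.pos
        have hdivcop : (m / p).Coprime N :=
          Nat.Coprime.coprime_dvd_left (Nat.div_dvd_of_dvd hpm) hmcop
        rw [if_pos hpm, hc, cuspCoeff_smul_gamma1, ih _ hdivn hdiv0 hdivcop, mul_zero, mul_zero,
          add_zero] at key
        exact key.symm
      · rw [if_neg hpm, mul_zero, add_zero] at key
        exact key.symm
    · -- `n = 1`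
      obtain rfl : n = 1 := le_antisymm hn1 hn0
      exact h1

end Coeff

/-! ### Consequences of the Main Lemma on `Γ₁(N)` (Diamond–Shurman Thm. 5.7.1, the named fact
`atkinLehnerMainLemma1`) -/

section MainLemma

variable (N : ℕ) [NeZero N] (k : ℤ)

/-- **Main Lemma ⇒ oldform** (Diamond–Shurman Thm. 5.7.1 with Def. 5.6.1): under
`atkinLehnerMainLemma1 N k`, a cusp form `f ∈ S_k(Γ₁(N))` whose coefficients `a_n(f)`, `n ≥ 1`
prime to `N`, vanish lies in `S_k(Γ₁(N))^{old}`: the Main Lemma writes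
`f = ∑_{p ∣ N} p^{1-k} • (g_p ∣[k] α_p)` with `g_p ∈ S_k(Γ₁(N/p))`, and `g_p ∣[k] α_p =
degeneracyMap1 (N/p) N p k g_p` (`coe_degeneracyMap1_eq_slash`) lies in the old subspace
(`N/p` is a proper divisor of `N`). [cite: DiamondShurman2005, Thm. 5.7.1] -/
theorem mem_oldSubspace1_of_coeff_eq_zero (hML : atkinLehnerMainLemma1 N k)
    (f : CuspForm (Gamma1 N) k)
    (hf : ∀ n : ℕ, 0 < n → n.Coprime N → (qExpansion 1 ⇑f).coeff n = 0) :
    f ∈ oldSubspace1 N k := by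
  obtain ⟨g, hg⟩ := hML f hf
  have hsum : f = ∑ p : N.primeFactors,
      ((p : ℕ) : ℂ) ^ (1 - k) • degeneracyMap1 (N / p) N p k (g p) := by
    apply DFunLike.coe_injective
    rw [hg, coe_cuspForm_finset_sum]
    refine Finset.sum_congr rfl fun p _ ↦ ?_
    rw [CuspForm.IsGLPos.coe_smul, coe_degeneracyMap1_eq_slash (N / p) N p k
      (div_mul_dvd_of_mem_primeFactors p)]
  rw [hsum]
  refine Submodule.sum_mem _ fun p _ ↦ Submodule.smul_mem _ _ ?_
  refine range_degeneracyMap1_le_oldSubspace1 N k ?_ (div_mul_dvd_of_mem_primeFactors p)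
    (LinearMap.mem_range_self _ _)
  have hp := Nat.prime_of_mem_primeFactors p.2
  rw [Nat.mem_properDivisors]
  exact ⟨Nat.div_dvd_of_dvd (Nat.dvd_of_mem_primeFactors p.2),
    Nat.div_lt_self (NeZero.pos N) hp.one_lt⟩

variable {N k}

/-- **A new eigenform away from `N` with `a₁ = 0` vanishes** (Diamond–Shurman, proof of Thm. 5.8.2,
PDF p. 217: "if `a₁(f) = 0` then `a_n(f) = 0` when `(n, N) = 1` and so `f ∈ S_k(Γ₁(N))^{old}` by the
Main Lemma"; and `S_k(Γ₁(N))^{new} ∩ S_k(Γ₁(N))^{old} = {0}`): for `u ∈ S_k(Γ₁(N))^{new}` with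
`T_p u = a_p u` for all primes `p ∤ N`, `⟨d⟩ u = c_d u` for all `d`, and `a₁(u) = 0`, the coefficients
`a_n(u)`, `(n, N) = 1`, vanish (`cuspCoeff_eq_zero_of_coprime_gamma1`), so `u` is old by the Main
Lemma (`atkinLehnerMainLemma1`, Thm. 5.7.1) and hence `u = 0`
(`disjoint_oldSubspace1_newSubspace1_holds`). [cite: DiamondShurman2005, Thm. 5.8.2 (proof)] -/
theorem eq_zero_of_mem_newSubspace1_of_coeff_one_eq_zero (hML : atkinLehnerMainLemma1 N k)
    {u : CuspForm (Gamma1 N) k} (hu : u ∈ newSubspace1 N k) (a : ℕ → ℂ)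
    (hT : ∀ (p : ℕ) (hp : p.Prime), ¬ p ∣ N →
      (haveI : NeZero p := ⟨hp.ne_zero⟩; heckeT (Gamma1 N) k p u) = a p • u)
    (hD : ∀ d : (ZMod N)ˣ, ∃ c : ℂ, diamondOp N k (d : ZMod N) u = c • u)
    (h1 : (qExpansion 1 ⇑u).coeff 1 = 0) : u = 0 := by
  have hcoeff := cuspCoeff_eq_zero_of_coprime_gamma1 u a hT hD h1
  have hold : u ∈ oldSubspace1 N k :=
    mem_oldSubspace1_of_coeff_eq_zero N k hML u fun n hn0 hn ↦ hcoeff n hn0 hn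
  exact (Submodule.disjoint_def.mp (disjoint_oldSubspace1_newSubspace1_holds N k)) _ hold hu

/-- **Diamond–Shurman Thm. 5.8.2(a) on `Γ₁(N)`, given the Main Lemma**: let `u ∈ S_k(Γ₁(N))^{new}`
be nonzero with `T_p u = a_p u` for all primes `p ∤ N` and `⟨d⟩ u = c_d u` for all `d ∈ (ℤ/Nℤ)ˣ`.
Then `a₁(u) ≠ 0` and `u = a₁(u) • f` for a **newform** `f` (`IsNewform1 f`: `f = a₁(u)⁻¹ u` is new,
normalised, an eigenform of the `⟨d⟩` and of `T_p` for `p ∤ N`, and for `p ∣ N` the form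
`g = U_p f - a₁(U_p f) f` is new (`heckeT_mem_newSubspace1`, Prop. 5.6.2), is an eigenform away from
`N` with the eigenvalues of `f` (the `T_q` commute with `U_p`, `heckeT_comm_of_prime`; the `⟨d⟩`
commute with `U_p`, `heckeT_diamondOp_comm_holds`) and has `a₁(g) = 0`, so `g = 0` by
`eq_zero_of_mem_newSubspace1_of_coeff_one_eq_zero`: "`g_m ∈ S_k(Γ₁(N))^{new} ∩ S_k(Γ₁(N))^{old}
= {0}`, i.e., `T_m f = a_m(f) f`", p. 218). [cite: DiamondShurman2005, Thm. 5.8.2(a)] -/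
theorem exists_isNewform1_of_mem_newSubspace1 (hML : atkinLehnerMainLemma1 N k)
    {u : CuspForm (Gamma1 N) k} (hu : u ∈ newSubspace1 N k) (hu0 : u ≠ 0) (a : ℕ → ℂ)
    (hT : ∀ (p : ℕ) (hp : p.Prime), ¬ p ∣ N →
      (haveI : NeZero p := ⟨hp.ne_zero⟩; heckeT (Gamma1 N) k p u) = a p • u)
    (hD : ∀ d : (ZMod N)ˣ, ∃ c : ℂ, diamondOp N k (d : ZMod N) u = c • u) :
    ∃ f : CuspForm (Gamma1 N) k, IsNewform1 f ∧ u = (qExpansion 1 ⇑u).coeff 1 • f := by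
  set c : ℂ := (qExpansion 1 ⇑u).coeff 1 with hc_def
  have hc : c ≠ 0 := fun hc ↦ hu0 (eq_zero_of_mem_newSubspace1_of_coeff_one_eq_zero hML hu a hT hD hc)
  set f : CuspForm (Gamma1 N) k := c⁻¹ • u with hf_def
  have hf_new : f ∈ newSubspace1 N k := Submodule.smul_mem _ _ hu
  have hf1 : IsNormalized f := by
    show cuspCoeff f 1 = 1
    rw [hf_def, cuspCoeff_smul_gamma1, show cuspCoeff u 1 = c from rfl, inv_mul_cancel₀ hc]
  have hfT : ∀ (p : ℕ) (hp : p.Prime), ¬ p ∣ N →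
      (haveI : NeZero p := ⟨hp.ne_zero⟩; heckeT (Gamma1 N) k p f) = a p • f := fun p hp hpN ↦ by
    haveI : NeZero p := ⟨hp.ne_zero⟩
    rw [hf_def, map_smul, hT p hp hpN, smul_comm]
  have hfD : ∀ d : (ZMod N)ˣ, ∃ c : ℂ, diamondOp N k (d : ZMod N) f = c • f := fun d ↦ by
    obtain ⟨e, he⟩ := hD d
    refine ⟨e, ?_⟩
    rw [hf_def, map_smul, he, smul_comm]
  have hf_eigen : IsHeckeEigenform f := by
    intro p hp
    haveI : NeZero p := ⟨hp.ne_zero⟩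
    by_cases hpN : p ∣ N
    · -- `U_p`: the form `g - a₁(g) f`, `g = U_p f`, is new with `a₁ = 0`
      set g : CuspForm (Gamma1 N) k := heckeT (Gamma1 N) k p f with hg_def
      set b : ℂ := cuspCoeff g 1 with hb_def
      refine ⟨b, ?_⟩
      have hx_new : g - b • f ∈ newSubspace1 N k :=
        Submodule.sub_mem _ (heckeT_mem_newSubspace1 N k hp hf_new) (Submodule.smul_mem _ _ hf_new)
      have hxT : ∀ (q : ℕ) (hq : q.Prime), ¬ q ∣ N →
          (haveI : NeZero q := ⟨hq.ne_zero⟩; heckeT (Gamma1 N) k q (g - b • f)) =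
            a q • (g - b • f) := fun q hq hqN ↦ by
        haveI : NeZero q := ⟨hq.ne_zero⟩
        have hcomm : heckeT (Gamma1 N) k q (heckeT (Gamma1 N) k p f) =
            heckeT (Gamma1 N) k p (heckeT (Gamma1 N) k q f) := by
          rw [← Module.End.mul_apply, heckeT_comm_of_prime hq hp k, Module.End.mul_apply]
        rw [map_sub, map_smul, hg_def, hcomm, hfT q hq hqN, map_smul, smul_sub, smul_comm]
      have hxD : ∀ d : (ZMod N)ˣ, ∃ c : ℂ, diamondOp N k (d : ZMod N) (g - b • f) = c • (g - b • f) :=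
          fun d ↦ by
        obtain ⟨e, he⟩ := hfD d
        refine ⟨e, ?_⟩
        have hcomm : diamondOp N k (d : ZMod N) (heckeT (Gamma1 N) k p f) =
            heckeT (Gamma1 N) k p (diamondOp N k (d : ZMod N) f) := by
          rw [← Module.End.mul_apply, ← heckeT_diamondOp_comm_holds N k p (d : ZMod N),
            Module.End.mul_apply]
        rw [map_sub, map_smul, hg_def, hcomm, he, map_smul, smul_sub, smul_comm]
      have hx1 : (qExpansion 1 ⇑(g - b • f)).coeff 1 = 0 := by
        change cuspCoeff (g - b • f) 1 = 0
        rw [cuspCoeff_sub_gamma1, cuspCoeff_smul_gamma1, show cuspCoeff f 1 = 1 from hf1, mul_one,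
          hb_def, sub_self]
      have hx := eq_zero_of_mem_newSubspace1_of_coeff_one_eq_zero hML hx_new a hxT hxD hx1
      rwa [sub_eq_zero] at hx
    · exact ⟨a p, hfT p hp hpN⟩
  refine ⟨f, ⟨hf_new, hf_eigen, hfD, hf1⟩, ?_⟩
  rw [hf_def, smul_smul, mul_inv_cancel₀ hc, one_smul]

/-- Corollary: under the Main Lemma, a new eigenform away from `N` (for the `T_p`, `p ∤ N`, and the
`⟨d⟩`) lies in the span of the newforms (Diamond–Shurman Thm. 5.8.2(a)). [cite: DiamondShurman2005, Thm. 5.8.2(a)] -/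
theorem mem_span_newforms1_of_mem_newSubspace1 (hML : atkinLehnerMainLemma1 N k)
    {u : CuspForm (Gamma1 N) k} (hu : u ∈ newSubspace1 N k) (a : ℕ → ℂ)
    (hT : ∀ (p : ℕ) (hp : p.Prime), ¬ p ∣ N →
      (haveI : NeZero p := ⟨hp.ne_zero⟩; heckeT (Gamma1 N) k p u) = a p • u)
    (hD : ∀ d : (ZMod N)ˣ, ∃ c : ℂ, diamondOp N k (d : ZMod N) u = c • u) :
    u ∈ Submodule.span ℂ (newforms1 N k) := by
  by_cases hu0 : u = 0
  · rw [hu0]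
    exact Submodule.zero_mem _
  · obtain ⟨f, hf, huf⟩ := exists_isNewform1_of_mem_newSubspace1 hML hu hu0 a hT hD
    rw [huf]
    exact Submodule.smul_mem _ _ (Submodule.subset_span hf)

end MainLemma

/-! ### The assembly: `S_k(Γ₁(N))^{new} = span (newforms)` from the Main Lemma -/

section Assembly

variable (N : ℕ) [NeZero N] (k : ℤ)

/-- The diamond operators commute with each other (`⟨d⟩⟨e⟩ = ⟨de⟩ = ⟨e⟩⟨d⟩` for units,
`diamondOp_mul_holds`; non-units act as the identity). [folklore] -/
theorem diamondOp_comm (d e : ZMod N) :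
    diamondOp N k d * diamondOp N k e = diamondOp N k e * diamondOp N k d := by
  by_cases hd : IsUnit d
  swap
  · rw [diamondOp_of_not_isUnit hd]
    rfl
  by_cases he : IsUnit e
  swap
  · rw [diamondOp_of_not_isUnit he]
    rfl
  rw [← diamondOp_mul_holds N k hd he, ← diamondOp_mul_holds N k he hd, mul_comm]

/-- **The newforms span the new subspace of `S_k(Γ₁(N))`, given the Main Lemma** (Diamond–Shurman
Thm. 5.8.2: "The set of newforms in the space `S_k(Γ₁(N))^{new}` is an orthogonal basis of the
space"; Li 1975, Thm. 3 / Cor. 3): if `atkinLehnerMainLemma1 N k` (Thm. 5.7.1) holds then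
`Submodule.span ℂ (newforms1 N k) = newSubspace1 N k`. Proof as printed (Cor. 5.6.3 and
Thm. 5.8.2(a), PDF pp. 210, 216–218): `⊆` is the definition of a newform; for `⊇`, the
finite-dimensional (`finiteDimensional_cuspForm_gamma1`) new subspace `V` is the sum of the joint
generalised eigenspaces of the commuting family of restrictions `{T_p|_V : p ∤ N} ∪ {⟨d⟩|_V}`
(`heckeT_mem_newSubspace1`, `diamondOp_mem_newSubspace1`, Prop. 5.6.2; commutativity
`heckeT_comm_of_prime`, `heckeT_diamondOp_comm_holds`, `diamondOp_comm`, Prop. 5.2.4; Mathlib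
`Module.End.iSup_iInf_maxGenEigenspace_eq_top_of_iSup_maxGenEigenspace_eq_top_of_commute`); these
are joint eigenspaces because each operator is *normal* for the positive definite Petersson product
on `V` (Thm. 5.5.3: `T_p^* = [Γ₁(N) diag(p,1) Γ₁(N)] = T_p ⟨p⟩⁻¹`,
`exists_heckeTAdjoint_eq_heckeT_mul_diamondOp` and `peterssonProduct_heckeT_left_gamma1`;
`⟨d⟩^* = ⟨d⁻¹⟩`, `peterssonProduct_diamondOp_left`; `maxGenEigenspace_eq_eigenspace_of_normal`,
Thm. 5.5.4), and a joint eigenvector is a multiple of a newform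
(`mem_span_newforms1_of_mem_newSubspace1`, Thm. 5.8.2(a), where the Main Lemma enters).
[cite: DiamondShurman2005, Thm. 5.8.2] [cite: Li1975, Thm. 3 and Cor. 3] -/
theorem span_newforms1_of_mainLemma1 (hML : atkinLehnerMainLemma1 N k) : span_newforms1 N k := by
  unfold span_newforms1
  refine le_antisymm (Submodule.span_le.mpr fun f hf ↦ hf.1) ?_
  haveI : FiniteDimensional ℂ (CuspForm (Gamma1 N) k) := finiteDimensional_cuspForm_gamma1 N k
  set V : Submodule ℂ (CuspForm (Gamma1 N) k) := newSubspace1 N k with hV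
  -- the index set: primes away from the level, and units mod `N`
  let P : Type := {p : Nat.Primes // ¬ ((p : ℕ) ∣ N)}
  haveI hP0 : ∀ p : P, NeZero ((p.1 : ℕ)) := fun p ↦ ⟨p.1.2.ne_zero⟩
  let ι : Type := P ⊕ (ZMod N)ˣ
  -- the ambient operators and their restrictions to `V`
  let A : ι → Module.End ℂ (CuspForm (Gamma1 N) k) := fun i ↦
    match i with
    | Sum.inl p => heckeT (Gamma1 N) k (p.1 : ℕ)
    | Sum.inr d => diamondOp N k (d : ZMod N)
  have hA : ∀ i, ∀ f ∈ V, A i f ∈ V := by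
    rintro (p | d) f hf
    · exact heckeT_mem_newSubspace1 N k p.1.2 hf
    · exact diamondOp_mem_newSubspace1 N k _ hf
  have hAcomm : ∀ i j, A i * A j = A j * A i := by
    rintro (p | d) (q | e)
    · exact heckeT_comm_of_prime p.1.2 q.1.2 k
    · exact heckeT_diamondOp_comm_holds N k (p.1 : ℕ) (e : ZMod N)
    · exact (heckeT_diamondOp_comm_holds N k (q.1 : ℕ) (d : ZMod N)).symm
    · exact diamondOp_comm N k _ _
  let T : ι → Module.End ℂ V := fun i ↦ (A i).restrict (hA i)
  have hcomm : Pairwise fun i j ↦ Commute (T i) (T j) := fun i j _ ↦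
    LinearMap.restrict_commute (hAcomm i j) _ _
  have htop : ⨆ χ : ι → ℂ, ⨅ i, (T i).maxGenEigenspace (χ i) = ⊤ :=
    Module.End.iSup_iInf_maxGenEigenspace_eq_top_of_iSup_maxGenEigenspace_eq_top_of_commute T hcomm
      fun i ↦ Module.End.iSup_maxGenEigenspace_eq_top (T i)
  -- the Petersson form on `V` and the adjoint partners: every `T i` is normal
  let B : V → V → ℂ := fun x y ↦ peterssonProduct (Gamma1 N) k (x : CuspForm (Gamma1 N) k) y
  have hB_add : ∀ u v w, B u (v + w) = B u v + B u w := fun u v w ↦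
    peterssonProduct_add_right k (u : CuspForm (Gamma1 N) k) v w
  have hB_smul : ∀ (c : ℂ) (v w : V), B v (c • w) = c * B v w := fun c v w ↦
    peterssonProduct_smul_right (Gamma1 N) k c (v : CuspForm (Gamma1 N) k) w
  have hB_conj : ∀ v w, B w v = conj (B v w) := fun v w ↦
    peterssonProduct_conj_symm_holds (Gamma1 N) k (v : CuspForm (Gamma1 N) k) w
  have hB_def : ∀ v, B v v = 0 → v = 0 := fun v hv ↦
    Subtype.ext (eq_zero_of_peterssonProduct_self_eq_zero k (v : CuspForm (Gamma1 N) k) hv)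
  have hgen : ∀ (i : ι) (μ : ℂ), (T i).maxGenEigenspace μ = (T i).eigenspace μ := by
    rintro (p | d) μ
    · -- `T_p`, `p ∤ N`: adjoint partner `T_p ⟨u⟩`, `u p ≡ 1`
      obtain ⟨u, -, hu⟩ := exists_heckeTAdjoint_eq_heckeT_mul_diamondOp N k (p.1 : ℕ) p.1.2 p.2
      have hA' : ∀ f ∈ V, (heckeT (Gamma1 N) k (p.1 : ℕ) * diamondOp N k u) f ∈ V := fun f hf ↦
        heckeT_mem_newSubspace1 N k p.1.2 (diamondOp_mem_newSubspace1 N k u hf)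
      refine maxGenEigenspace_eq_eigenspace_of_normal B hB_add hB_smul hB_conj hB_def (T (Sum.inl p))
        ((heckeT (Gamma1 N) k (p.1 : ℕ) * diamondOp N k u).restrict hA') (fun v w ↦ ?_) ?_ μ
      · change peterssonProduct (Gamma1 N) k (heckeT (Gamma1 N) k (p.1 : ℕ) (v : CuspForm (Gamma1 N) k)) w =
          peterssonProduct (Gamma1 N) k (v : CuspForm (Gamma1 N) k)
            ((heckeT (Gamma1 N) k (p.1 : ℕ) * diamondOp N k u) (w : CuspForm (Gamma1 N) k))
        rw [peterssonProduct_heckeT_left_gamma1, hu]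
      · refine (LinearMap.restrict_commute ?_ _ _).eq
        change heckeT (Gamma1 N) k (p.1 : ℕ) * (heckeT (Gamma1 N) k (p.1 : ℕ) * diamondOp N k u) =
          heckeT (Gamma1 N) k (p.1 : ℕ) * diamondOp N k u * heckeT (Gamma1 N) k (p.1 : ℕ)
        rw [mul_assoc, ← heckeT_diamondOp_comm_holds N k (p.1 : ℕ) u]
    · -- `⟨d⟩`: adjoint partner `⟨d⁻¹⟩`
      have hA' : ∀ f ∈ V, diamondOp N k ((d⁻¹ : (ZMod N)ˣ) : ZMod N) f ∈ V := fun f hf ↦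
        diamondOp_mem_newSubspace1 N k _ hf
      refine maxGenEigenspace_eq_eigenspace_of_normal B hB_add hB_smul hB_conj hB_def (T (Sum.inr d))
        ((diamondOp N k ((d⁻¹ : (ZMod N)ˣ) : ZMod N)).restrict hA') (fun v w ↦ ?_) ?_ μ
      · exact peterssonProduct_diamondOp_left N k d (v : CuspForm (Gamma1 N) k) w
      · exact (LinearMap.restrict_commute (diamondOp_comm N k _ _) _ _).eq
  -- every joint generalised eigenspace lies in the span of the newforms
  intro u hu
  have hmem : (⟨u, hu⟩ : V) ∈ ⨆ χ : ι → ℂ, ⨅ i, (T i).maxGenEigenspace (χ i) := by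
    rw [htop]
    exact Submodule.mem_top
  suffices h : ∀ χ : ι → ℂ, ⨅ i, (T i).maxGenEigenspace (χ i) ≤
      (Submodule.span ℂ (newforms1 N k)).comap V.subtype from (iSup_le h) hmem
  intro χ v hv
  rw [Submodule.mem_comap, Submodule.subtype_apply]
  classical
  -- the `T_p`-eigenvalues as a function on `ℕ`
  let a : ℕ → ℂ := fun n ↦ if h : n.Prime ∧ ¬ n ∣ N then χ (Sum.inl ⟨⟨n, h.1⟩, h.2⟩) else 0
  have hv_eigen : ∀ i, T i v = χ i • v := fun i ↦ by
    have h := (Submodule.mem_iInf _).mp hv i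
    rwa [hgen, Module.End.mem_eigenspace_iff] at h
  refine mem_span_newforms1_of_mem_newSubspace1 hML v.2 a (fun p hp hpN ↦ ?_) (fun d ↦ ?_)
  · haveI : NeZero p := ⟨hp.ne_zero⟩
    have h' : heckeT (Gamma1 N) k p (v : CuspForm (Gamma1 N) k) =
        χ (Sum.inl ⟨⟨p, hp⟩, hpN⟩) • (v : CuspForm (Gamma1 N) k) :=
      congrArg (Subtype.val : V → CuspForm (Gamma1 N) k) (hv_eigen (Sum.inl ⟨⟨p, hp⟩, hpN⟩))
    simpa [a, hp, hpN] using h'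
  · exact ⟨χ (Sum.inr d), congrArg (Subtype.val : V → CuspForm (Gamma1 N) k) (hv_eigen (Sum.inr d))⟩

end Assembly

end Literature.NumberTheory.EllipticCurves.ModularForms

end
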